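import Mathlib.Analysis.SpecialFunctions.Pow.Real
import Literature.InformationTheory.QuantumCodes.CorrectableRegions
import HarnessLib

/-!
# Bravyi–Poulin–Terhal 2010, Eq. (2): `k · d^{2/(D−1)} ≤ c n` for local stabilizer codes on the `D`-dimensional torus — proof

S. Bravyi, D. Poulin, B. Terhal, *Tradeoffs for reliable quantum information storage in 2D systems*, Phys. Rev.
Lett. 104 (2010) 050503 = arXiv:0909.5200 [BravyiPoulinTerhal2010]. The Letter proves `k ≤ c n/d²` (Eq. (1)) for
codes with geometrically local commuting projectors on the `√n × √n` square lattice with open boundaries and states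
(arXiv p. 2, chunk p0003 L5–6): «Generalizing our techniques to quantum codes defined on a `D`-dimensional lattice
yields `k ≤ c n/d^α`, `α = 2/(D−1)`» (Eq. (2)), with the footnote (p0003 L24–26) «More strictly, our analysis applies
to the regular `D`-dimensional cubic lattice with open or periodic boundary conditions» and (p0002 L32–33) «our
results can be easily extended to more general 2D lattices and periodic boundary conditions». The tree has the
STABILIZER/qubit case of Eq. (1) with open boundaries as the named fact `BravyiPoulinTerhal2010_kd2_le_cn`
(`LocalityBounds.lean`), PROVED in `LocalCodeTradeoff.lean`, whose docstring leaves «the `D`-dimensional Eq. (2)»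
and «periodic boundary conditions» as `TODO(general form)`. THIS FILE PROVES BOTH, for stabilizer codes on qubits:

* `BravyiPoulinTerhal2010_eq2_torus`: for every `D ≥ 2` and range `w` there is `c = c(w,D) > 0` such that every
  stabilizer code on the torus `(ℤ/L)^D` (`n = L^D` qubits placed by `e : Fin n ≃ (Fin D → Fin L)`) whose
  stabilizer space is spanned by generators each covered by a hypercube with `w^D` vertices modulo `L`
  (`HasLocalGeneratorsPeriodic`, `LocalityBounds.lean`) has `k · d^{2/(D−1)} ≤ c · n`;
* `BravyiPoulinTerhal2010_eq2`: the same with open boundaries (`HasLocalGenerators`; an open-boundary hypercube is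
  contained in the periodic one with the same corner, `HasLocalGenerators.toPeriodic`);
* `BravyiPoulinTerhal2010_kd2_le_cn_torus`: `D = 2`, `k d² ≤ c n` on the `L × L` torus — the periodic form of
  the named fact (which follows from it by `HasLocalGenerators.toPeriodic`; its own discharge
  `BravyiPoulinTerhal2010_kd2_le_cn_holds` in `LocalCodeTradeoff.lean` stays the tree's proof of Eq. (1)).

The constant is explicit and far from optimal: `c = 36 D² t² · C_B^{2/(D−1)}`, `t = max(w,2) − 1`,
`C_B = 4tD·2^{D−1} + (6t)^D + 4tD(7t)^{D−1} + 1`.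

## Proof (the Letter's pp. 2–4, run in `D` dimensions on the torus; region lemmas from `CorrectableRegions.lean`)

The Letter prints no details for Eq. (2); the `D`-dimensional bookkeeping below is the one sketched in print by
Flammia–Haah–Kastoryano–Kim [FlammiaEtAl2017, §3, proof of Thm. 9, Steps 1–3] (for the more general locally
correctable codes; «We state and prove the theorem for a two-dimensional Euclidean lattice … but the proof
generalizes easily to `D`-dimensional lattices with `D ≥ 2`»; with `δ = 0` «We then recover the bound
`kd^{2/(D−1)} ≤ O(n)` of Ref. [BPT]»): hypercube blocks of side `R ∼ (d/w)^{1/(D−1)}` grown by the Expansion Lemma,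
a region of codimension-`2` «corners»/«bar segments» of size `O(w² n/R²)`, and `k ≤ |·|` of that region. Concretely:

1. NEAR-EQUAL CYCLIC PERIODS (§1, the torus seam — ours): the circle `ℤ/L` is cut into `Q = ⌈L/(R+t)⌉` consecutive
   arcs, column `x` lying in period `⌊xQ/L⌋` (`BPTTorus.per`); the CORRIDOR of a period is its last `t` columns, a
   column is BAD if it is within `t` of a block boundary (`NearStart ∨ NearEnd`). All separation facts («two block
   columns / two corridor columns at cyclic distance `≤ t` lie in the same period», «a column within `t` of a corridor
   column is bad») follow from the monotonicity of `x ↦ ⌊xQ/L⌋` and `2tQ ≤ L`; `|bad| ≤ 3tQ` via the period starts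
   `⌈iL/Q⌉`. (With open boundaries the Letter's pattern of period `R + w` is simply truncated at the edge; on the
   torus the periods must tile `ℤ/L` exactly, whence the near-equal arcs.)
2. HYPERCUBES AND FRAMES (§2): relative coordinates `(x_j − o_j) mod L`; the frame of thickness `t` around the cube
   `[t, t+m)^D` is `[0, m+2t)^D ∖ [2t, m)^D`, of exactly `(m+2t)^D − (m−2t)^D ≤ 4tD(m+2t)^{D−1}` qubits when
   `m + 2t ≤ L`; a generator of range `t + 1` meeting the cube and its complement lies in the frame («the condition
   `∂M ⊆ BC` is satisfied» — in these coordinates the generator's window does not wrap around).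
3. GROWTH («`R ≥ d/(cw)`», §3): single sites are correctable (`d ≥ 2`); Cor. 1 (`IsCorrectableRegion.union_of_crossing`)
   grows every correctable `m`-cube to an `(m+2t)`-cube while the frame has `< d` qubits and does not wrap; the
   process ends with EVERY `R`-cube correctable and either `d ≤ (R+2t)^D − (R−2t)^D` or `L < R + 2t`.
4. PARTITION `Λ = A ∪ B ∪ C` (§4, Fig. 1 in `D` dimensions): `C` = qubits with `≥ 2` bad coordinates
   (`|C| ≤ D²(3tQ)² L^{D−2}`), `A` = all coordinates in block columns (label: the vector of period indices; each
   block inside an `R`-cube), `B` = exactly one bad coordinate, a corridor one (label: direction + period indices; each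
   segment inside an `R`-cube). Generators meet at most one block / one segment (step 1), so `A` and `B` are
   correctable by the Union Lemma (`isCorrectableRegion_of_fibers`) and `k ≤ |C|` by Eqs. (5)–(8)
   (`le_card_compl_of_isCorrectable`).
5. ARITHMETIC (§5): with `p = R + t`, `Qp ≤ 2L` and `d ≤ 4tD(2p)^{D−1}` this is `k p² ≤ 36D²t² n`,
   `d ≤ C_B p^{D−1}`; the degenerate regimes (torus smaller than `6t`; blocks smaller than `5t`; blocks outgrowing the
   torus, where the Cleaning Lemma gives `d ≤ |Λ ∖ cube| ≤ 2tD L^{D−1}` (`dist_le_card_compl_of_isCorrectableRegion`)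
   and two periods give `k ≤ 36D²t²L^{D−2}`; fewer than one period; `d ≤ 1`) give the same two inequalities with
   `p` replaced by `L` or `1` (`BPTTorus.exists_scale`); finally `d^{2/(D−1)} ≤ C_B^{2/(D−1)} p²` (`BPTTorus.real_step`).

Deliberately NOT here (as for the named fact): commuting-projector / qudit codes (the Letter's generality; the tree's
vocabulary is stabilizer codes on qubits), subsystem codes («`kd^{1/(D−1)} ≤ O(n)`», Bravyi 2011, as quoted in
[FlammiaEtAl2017, §1.1]), the approximate / locally-correctable generality and the logarithmic factors of
[FlammiaEtAl2017, Thm. 9], non-cubic lattices, any attempt at a good constant. `D = 1` is excluded from the statement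
(`α = 2/(D−1)`); for `D = 1` Bravyi–Terhal's `d ≤ r` (`LocalCodeDistanceBound.lean`) is the relevant bound.

## References

* [BravyiPoulinTerhal2010] arXiv:0909.5200, read via `lit`: setting and «periodic boundary conditions» (chunk p0002
  L28–33), Eq. (1) (p0002 L50–54), Eq. (2) and the footnote on boundary conditions (p0003 L5–12, L24–26), proof
  of Eq. (1): Eqs. (5)–(8), «`R ≥ d/(cw)`», Def. 1, Cor. 1, Lemma 2 (pp. 3–4; locators in `LocalCodeTradeoff.lean`).
* [FlammiaEtAl2017] S. T. Flammia, J. Haah, M. J. Kastoryano, I. H. Kim, *Limits on the storage of quantum information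
  in a volume of space*, Quantum 1 (2017) 4 = arXiv:1610.06169, read via `lit`: §1.1 «[BPT] … also showed that
  `k d^{2/(D−1)} ≤ O(n)`» (chunk p0004 L29–30); §3 Thm. 9 and its proof, Steps 1–3 (p0009 L1–60, p0010 L1–78:
  hypercubes of linear size `O((d/ℓ)^{1/(D−1)})`, «`(D−2)`-dimensional corners of width `ℓ` removed», «bar segments»,
  `k(1 − Õ(ε)) ≤ O(|Z|) = O(n) ℓ^{2D/(D−1)} d^{−2/(D−1)}`).
* [BravyiTerhal2009] Lemma 1 (Cleaning Lemma; `QuantumSingletonBound.lean`) and the periodic hypercubes of §1/§5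
  (`LocalityBounds.lean`).

## Mathlib / tree search

Tree: `IsCorrectableRegion`, `.of_card_lt`, `.mono`, `.union_of_crossing`, `isCorrectableRegion_of_fibers`,
`le_card_compl_of_isCorrectable`, `not_isCorrectableRegion_univ`, `fiber` (CorrectableRegions.lean);
`sup_sympDual_inf_supportedOn_compl_eq`, `sympWeight_le_card_of_mem` (QuantumSingletonBound.lean); `InCube`,
`InCubePeriodic`, `IsCubeLocal(Periodic)`, `HasLocalGenerators(Periodic)`, `sympSupport`,
`BravyiPoulinTerhal2010_kd2_le_cn` (LocalityBounds.lean). The open-boundary 2D file `LocalCodeTradeoff.lean` is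
not imported (its squares are read inside `{0,…,L−1}²`; here everything is modulo `L`). Mathlib: `Fin.coe_sub_iff_le`,
`Fin.coe_sub_iff_lt`, `Fintype.card_piFinset`, `Finset.attachFin`, `Finset.prod_ite`, `Nat.find`,
`Nat.div_lt_iff_lt_mul`, `Nat.le_div_iff_mul_le`, `Real.rpow_natCast`, `Real.rpow_mul`, `Real.rpow_le_rpow`,
`Real.mul_rpow`.
-/

namespace Literature.InformationTheory.QuantumCodes

open Finset Module
open Classical

namespace BPTTorus

/-! ### 1. Near-equal cyclic periods of the circle `ℤ/L` -/

section OneD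

variable {L Q t p : ℕ}

/-- The **period index** of the column `x ∈ {0,…,L−1}` when the circle `ℤ/L` is cut into `Q` consecutive
near-equal arcs («periods»): `⌊xQ/L⌋`. [cite: BravyiPoulinTerhal2010, p. 2 and Fig. 1 (the block pattern; periodic boundary conditions p. 1)] -/
def per (L Q x : ℕ) : ℕ := x * Q / L

/-- The first column of period `i`: `⌈iL/Q⌉`. [cite: BravyiPoulinTerhal2010, p. 2 and Fig. 1] -/
def pstart (L Q i : ℕ) : ℕ := (i * L + (Q - 1)) / Q

/-- The period index is monotone in the column. [folklore] -/
private theorem per_mono (L Q : ℕ) {x y : ℕ} (h : x ≤ y) : per L Q x ≤ per L Q y :=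
  Nat.div_le_div_right (Nat.mul_le_mul_right _ h)

/-- `i ≤ ⌊xQ/L⌋ ↔ iL ≤ xQ`. [folklore] -/
private theorem le_per_iff (hL : 0 < L) {i x : ℕ} : i ≤ per L Q x ↔ i * L ≤ x * Q :=
  Nat.le_div_iff_mul_le hL

/-- `⌊xQ/L⌋ < i ↔ xQ < iL`. [folklore] -/
private theorem per_lt_iff (hL : 0 < L) {i x : ℕ} : per L Q x < i ↔ x * Q < i * L :=
  Nat.div_lt_iff_lt_mul hL

/-- Columns `x < L` have period index `< Q`. [folklore] -/
private theorem per_lt (hQ : 0 < Q) (hL : 0 < L) {x : ℕ} (hx : x < L) : per L Q x < Q := by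
  rw [per_lt_iff hL, mul_comm Q L]
  exact Nat.mul_lt_mul_of_pos_right hx hQ

/-- `⌈iL/Q⌉ ≤ x ↔ iL ≤ xQ`. [folklore] -/
private theorem pstart_le_iff (hQ : 0 < Q) {i x : ℕ} : pstart L Q i ≤ x ↔ i * L ≤ x * Q := by
  unfold pstart
  obtain ⟨Q', rfl⟩ : ∃ Q', Q = Q' + 1 := ⟨Q - 1, by omega⟩
  rw [Nat.add_sub_cancel, ← Nat.lt_add_one_iff, Nat.div_lt_iff_lt_mul hQ]
  have e1 : (x + 1) * (Q' + 1) = x * (Q' + 1) + Q' + 1 := by ring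
  rw [e1]
  omega

/-- `x < ⌈iL/Q⌉ ↔ xQ < iL`. [folklore] -/
private theorem lt_pstart_iff (hQ : 0 < Q) {i x : ℕ} : x < pstart L Q i ↔ x * Q < i * L := by
  rw [← not_le, pstart_le_iff hQ, not_le]

/-- Period `0` starts at column `0`. [folklore] -/
private theorem pstart_zero : pstart L Q 0 = 0 := by
  unfold pstart
  rcases Nat.eq_zero_or_pos Q with hQ | hQ
  · simp [hQ]
  · simpa using Nat.div_eq_of_lt (Nat.sub_one_lt_of_le hQ le_rfl)

/-- `⌈QL/Q⌉ = L`: the periods tile the circle exactly. [folklore] -/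
private theorem pstart_self (hQ : 0 < Q) : pstart L Q Q = L := by
  unfold pstart
  rw [Nat.mul_add_div hQ, Nat.div_eq_of_lt (Nat.sub_one_lt_of_le hQ le_rfl), add_zero]

/-- Period starts are monotone. [folklore] -/
private theorem pstart_mono {i j : ℕ} (h : i ≤ j) : pstart L Q i ≤ pstart L Q j :=
  Nat.div_le_div_right (by nlinarith)

/-- Consecutive period starts are at most `p` apart when `L ≤ Qp`. [cite: BravyiPoulinTerhal2010, p. 2 and Fig. 1] -/
theorem pstart_succ_le (hQ : 0 < Q) (hLQ : L ≤ Q * p) (i : ℕ) :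
    pstart L Q (i + 1) ≤ pstart L Q i + p := by
  unfold pstart
  rw [← Nat.add_mul_div_right _ _ hQ]
  exact Nat.div_le_div_right (by nlinarith)

/-- `iL ≤ ⌈iL/Q⌉·Q`. [folklore] -/
private theorem mul_le_pstart_mul (hQ : 0 < Q) (i : ℕ) : i * L ≤ pstart L Q i * Q := by
  unfold pstart
  have h1 := Nat.div_add_mod (i * L + (Q - 1)) Q
  have h2 := Nat.mod_lt (i * L + (Q - 1)) hQ
  have : Q * ((i * L + (Q - 1)) / Q) = (i * L + (Q - 1)) / Q * Q := by ring
  omega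

/-- `per x = i` gives `pstart i ≤ x < pstart (i+1)`. [cite: BravyiPoulinTerhal2010, p. 2 and Fig. 1] -/
theorem pstart_le_of_per_eq (hQ : 0 < Q) (hL : 0 < L) {i x : ℕ} (h : per L Q x = i) :
    pstart L Q i ≤ x ∧ x < pstart L Q (i + 1) := by
  constructor
  · rw [pstart_le_iff hQ, ← le_per_iff hL]; exact h.ge
  · rw [lt_pstart_iff hQ, ← per_lt_iff hL]; omega

/-- Columns of the same period are fewer than `L/Q` apart: `(y − x)·Q < L`. [cite: BravyiPoulinTerhal2010, p. 2 and Fig. 1] -/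
theorem sub_mul_lt_of_per_eq (hL : 0 < L) {x y : ℕ} (hxy : x ≤ y) (h : per L Q x = per L Q y) :
    (y - x) * Q < L := by
  have h1 : per L Q x * L ≤ x * Q := (le_per_iff hL).1 le_rfl
  have h2 : y * Q < (per L Q y + 1) * L := (per_lt_iff hL).1 (Nat.lt_succ_self _)
  rw [← h, Nat.add_mul, one_mul] at h2
  rw [Nat.sub_mul]
  have : x * Q ≤ y * Q := Nat.mul_le_mul_right _ hxy
  omega

/-- **Corridor**: the last `t` columns of a period. [cite: BravyiPoulinTerhal2010, p. 2 and Fig. 1 (region B: the streets between the R×R blocks)] -/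
def IsCorr (L Q t x : ℕ) : Prop := L ≤ x + t ∨ per L Q (x + t) ≠ per L Q x

/-- Within `t` after a period start. [cite: BravyiPoulinTerhal2010, p. 2 and Fig. 1 (corner regions C)] -/
def NearStart (L Q t x : ℕ) : Prop := x < t ∨ per L Q (x - t) ≠ per L Q x

/-- Within `2t` before a period end (the corridor and the last `t` columns of the block).
[cite: BravyiPoulinTerhal2010, p. 2 and Fig. 1 (corner regions C)] -/
def NearEnd (L Q t x : ℕ) : Prop := L ≤ x + 2 * t ∨ per L Q (x + 2 * t) ≠ per L Q x

/-- **Bad column**: within `t` of a block boundary (corridors included). [cite: BravyiPoulinTerhal2010, p. 2 and Fig. 1 («small corner regions taken out which make up the region C»)] -/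
def Bad (L Q t x : ℕ) : Prop := NearStart L Q t x ∨ NearEnd L Q t x

/-- Two columns of the circle `ℤ/L` at cyclic distance `≤ t` (the four order/wrap cases).
[cite: BravyiPoulinTerhal2010, p. 2 («interaction range w»; periodic boundary conditions p. 1)] -/
def Close (L t x y : ℕ) : Prop :=
  (x ≤ y ∧ y ≤ x + t) ∨ (y ≤ x ∧ x ≤ y + t) ∨ (x + L ≤ y + t) ∨ (y + L ≤ x + t)

/-- Cyclic closeness is symmetric. [folklore] -/
private theorem Close.symm {x y : ℕ} (h : Close L t x y) : Close L t y x := by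
  unfold Close at *; omega

/-- Corridor columns are within `2t` of their period end. [cite: BravyiPoulinTerhal2010, p. 2 and Fig. 1] -/
theorem IsCorr.nearEnd {x : ℕ} (h : IsCorr L Q t x) : NearEnd L Q t x := by
  rcases h with h | h
  · exact Or.inl (by omega)
  · by_cases hL : L ≤ x + 2 * t
    · exact Or.inl hL
    · right
      intro h'
      have h1 := per_mono L Q (show x ≤ x + t by omega)
      have h2 := per_mono L Q (show x + t ≤ x + 2 * t by omega)
      omega

/-- Corridor columns are bad. [cite: BravyiPoulinTerhal2010, p. 2 and Fig. 1 (region C contains the street crossings)] -/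
theorem IsCorr.bad {x : ℕ} (h : IsCorr L Q t x) : Bad L Q t x := Or.inr h.nearEnd

/-- The first `t` columns of a period are not corridor columns (periods are longer than `2t`).
[cite: BravyiPoulinTerhal2010, p. 2 and Fig. 1] -/
theorem not_isCorr_of_nearStart (hQ : 0 < Q) (hL : 0 < L) (h2 : 2 * t * Q ≤ L) {x : ℕ} (hx : x < L)
    (hns : NearStart L Q t x) : ¬ IsCorr L Q t x := by
  set i := per L Q x with hi
  have hiQ : i < Q := per_lt hQ hL hx
  have key : (x + t) * Q < (i + 1) * L := by
    rcases hns with h | h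
    · calc (x + t) * Q < (2 * t) * Q := by
            apply Nat.mul_lt_mul_of_pos_right _ hQ; omega
        _ ≤ L := by simpa [mul_comm, mul_assoc] using h2
        _ ≤ (i + 1) * L := by nlinarith
    · have hlt : per L Q (x - t) < i :=
        lt_of_le_of_ne (per_mono L Q (Nat.sub_le x t)) h
      rw [per_lt_iff hL] at hlt
      have : (x + t) * Q ≤ (x - t) * Q + 2 * t * Q := by
        rw [← Nat.add_mul]; exact Nat.mul_le_mul_right _ (by omega)
      nlinarith
  have hper : per L Q (x + t) = i := by
    have h1 : per L Q (x + t) < i + 1 := (per_lt_iff hL).2 key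
    have h2 : i ≤ per L Q (x + t) := per_mono L Q (by omega)
    omega
  have hxt : x + t < L := by
    have : (i + 1) * L ≤ Q * L := Nat.mul_le_mul_right _ hiQ
    nlinarith
  simp only [IsCorr, not_or, not_le, ne_eq, not_not]
  exact ⟨hxt, hper⟩

/-- Two block columns at cyclic distance `≤ t` lie in the same period (corridors have width `t`).
[cite: BravyiPoulinTerhal2010, p. 2 («any projector Π_a overlaps with at most one of» the blocks)] -/
theorem per_eq_of_close_of_not_isCorr {x y : ℕ} (hcx : ¬ IsCorr L Q t x) (hcy : ¬ IsCorr L Q t y)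
    (hc : Close L t x y) : per L Q x = per L Q y := by
  simp only [IsCorr, not_or, not_le, ne_eq, not_not] at hcx hcy
  rcases hc with h | h | h | h
  · have h1 := per_mono L Q h.1
    have h2 := per_mono L Q h.2
    omega
  · have h1 := per_mono L Q h.1
    have h2 := per_mono L Q h.2
    omega
  · omega
  · omega

/-- Two corridor columns at cyclic distance `≤ t` lie in the same period (blocks have width `≥ t`).
[cite: BravyiPoulinTerhal2010, p. 2 and Fig. 1] -/
theorem per_eq_of_close_of_isCorr (hQ : 0 < Q) (hL : 0 < L) (h2 : 2 * t * Q ≤ L) {x y : ℕ} (hx : x < L)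
    (hy : y < L) (hcx : IsCorr L Q t x) (hcy : IsCorr L Q t y) (hc : Close L t x y) :
    per L Q x = per L Q y := by
  rcases hc with h | h | h | h
  · by_contra hne
    have hlt : per L Q x < per L Q y := lt_of_le_of_ne (per_mono L Q h.1) hne
    refine not_isCorr_of_nearStart hQ hL h2 hy ?_ hcy
    by_cases hyt : y < t
    · exact Or.inl hyt
    · right
      have := per_mono L Q (show y - t ≤ x by omega)
      omega
  · by_contra hne
    have hlt : per L Q y < per L Q x := lt_of_le_of_ne (per_mono L Q h.1) (Ne.symm hne)
    refine not_isCorr_of_nearStart hQ hL h2 hx ?_ hcx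
    by_cases hxt : x < t
    · exact Or.inl hxt
    · right
      have := per_mono L Q (show x - t ≤ y by omega)
      omega
  · exact absurd hcx (not_isCorr_of_nearStart hQ hL h2 hx (Or.inl (by omega)))
  · exact absurd hcy (not_isCorr_of_nearStart hQ hL h2 hy (Or.inl (by omega)))

/-- A column at cyclic distance `≤ t` from a corridor column is bad.
[cite: BravyiPoulinTerhal2010, p. 2 and Fig. 1 (corridor segments shortened by the corner regions)] -/
theorem bad_of_close_of_isCorr (hQ : 0 < Q) (hL : 0 < L) (h2 : 2 * t * Q ≤ L) {x y : ℕ} (hx : x < L) (hy : y < L)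
    (hcx : IsCorr L Q t x) (hc : Close L t x y) : Bad L Q t y := by
  rcases hc with h | h | h | h
  · rcases lt_or_eq_of_le (per_mono L Q h.1) with hlt | heq
    · left
      by_cases hyt : y < t
      · exact Or.inl hyt
      · right
        have := per_mono L Q (show y - t ≤ x by omega)
        omega
    · right
      rcases hcx with hcx | hcx
      · exact Or.inl (by omega)
      · by_cases hL2 : L ≤ y + 2 * t
        · exact Or.inl hL2
        · right
          have h1 := per_mono L Q (show x ≤ x + t by omega)
          have h3 := per_mono L Q (show x + t ≤ y + 2 * t by omega)
          omega
  · rcases lt_or_eq_of_le (per_mono L Q h.1) with hlt | heq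
    · exfalso
      refine not_isCorr_of_nearStart hQ hL h2 hx ?_ hcx
      by_cases hxt : x < t
      · exact Or.inl hxt
      · right
        have := per_mono L Q (show x - t ≤ y by omega)
        omega
    · right
      rcases hcx with hcx | hcx
      · exact Or.inl (by omega)
      · by_cases hL2 : L ≤ y + 2 * t
        · exact Or.inl hL2
        · right
          have h1 := per_mono L Q (show x ≤ x + t by omega)
          have h3 := per_mono L Q (show x + t ≤ y + 2 * t by omega)
          omega
  · exact absurd hcx (not_isCorr_of_nearStart hQ hL h2 hx (Or.inl (by omega)))
  · exact Or.inl (Or.inl (by omega))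

/-- A block column of period `i` lies in `[pstart i, pstart i + p − t)` when `L ≤ Qp`.
[cite: BravyiPoulinTerhal2010, p. 2 («blocks of size R×R»)] -/
theorem block_offset (hQ : 0 < Q) (hL : 0 < L) (hLQ : L ≤ Q * p) {x i : ℕ}
    (hnc : ¬ IsCorr L Q t x) (hi : per L Q x = i) :
    pstart L Q i ≤ x ∧ x + t < pstart L Q i + p := by
  simp only [IsCorr, not_or, not_le, ne_eq, not_not] at hnc
  refine ⟨(pstart_le_of_per_eq hQ hL hi).1, ?_⟩
  have h1 : (x + t) * Q < (i + 1) * L := by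
    rw [← per_lt_iff hL]; omega
  have h2 := mul_le_pstart_mul (L := L) hQ i
  have h3 : (x + t) * Q < (pstart L Q i + p) * Q := by nlinarith
  exact Nat.lt_of_mul_lt_mul_right h3

/-- A corridor column of period `i` lies in `[pstart i + t, pstart i + p)` when `L ≤ Qp`.
[cite: BravyiPoulinTerhal2010, p. 2 and Fig. 1] -/
theorem corr_offset (hQ : 0 < Q) (hL : 0 < L) (h2 : 2 * t * Q ≤ L) (hLQ : L ≤ Q * p) {x i : ℕ}
    (hx : x < L) (hc : IsCorr L Q t x) (hi : per L Q x = i) :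
    pstart L Q i + t ≤ x ∧ x < pstart L Q i + p := by
  constructor
  · by_contra hlt
    rw [not_le] at hlt
    refine not_isCorr_of_nearStart hQ hL h2 hx ?_ hc
    by_cases hxt : x < t
    · exact Or.inl hxt
    · right
      have : per L Q (x - t) < i := by
        rw [per_lt_iff hL, ← lt_pstart_iff hQ]; omega
      omega
  · exact lt_of_lt_of_le (pstart_le_of_per_eq hQ hL hi).2 (pstart_succ_le hQ hLQ i)

/-- The bad columns, as a set of points of the circle `Fin L`. [cite: BravyiPoulinTerhal2010, p. 2 and Fig. 1 (region C)] -/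
noncomputable def badFin (L Q t : ℕ) : Finset (Fin L) := univ.filter fun s => Bad L Q t (s : ℕ)

/-- **At most `3t` bad columns per period**: `|bad| ≤ 3tQ`. [cite: BravyiPoulinTerhal2010, p. 2 and Fig. 1 («small corner regions»)] -/
theorem card_badFin_le (hQ : 0 < Q) (hL : 0 < L) (h2 : 2 * t * Q ≤ L) :
    #(badFin L Q t) ≤ 3 * t * Q := by
  classical
  set T : Finset ℕ := (range Q).biUnion fun i =>
    Ico (pstart L Q i) (pstart L Q i + t) ∪ Ico (pstart L Q (i + 1) - 2 * t) (pstart L Q (i + 1)) with hT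
  have hT_card : #T ≤ 3 * t * Q := by
    calc #T ≤ ∑ i ∈ range Q, #(Ico (pstart L Q i) (pstart L Q i + t) ∪
              Ico (pstart L Q (i + 1) - 2 * t) (pstart L Q (i + 1))) := card_biUnion_le
      _ ≤ ∑ _i ∈ range Q, 3 * t := by
          refine sum_le_sum fun i _ => ?_
          refine (card_union_le _ _).trans ?_
          simp only [Nat.card_Ico]
          omega
      _ = 3 * t * Q := by rw [sum_const, card_range, smul_eq_mul]; ring
  refine le_trans ?_ hT_card
  refine card_le_card_of_injOn Fin.val ?_ ?_
  · intro s hs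
    have hs' : Bad L Q t s := by simpa [badFin] using hs
    have hx : (s : ℕ) < L := s.isLt
    have hiQ : per L Q s < Q := per_lt hQ hL hx
    have hps := pstart_le_of_per_eq hQ hL (rfl : per L Q s = per L Q s)
    rw [mem_coe, hT, mem_biUnion]
    refine ⟨per L Q s, mem_range.2 hiQ, ?_⟩
    rw [mem_union, mem_Ico, mem_Ico]
    rcases hs' with hns | hne
    · left
      refine ⟨hps.1, ?_⟩
      rcases hns with h | h
      · have hi0 : per L Q s = 0 := by
          have h1 : (s : ℕ) * Q < t * Q := Nat.mul_lt_mul_of_pos_right h hQ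
          have : per L Q s < 1 := by
            rw [per_lt_iff hL]; nlinarith
          omega
        rw [hi0, pstart_zero]; omega
      · have hlt : per L Q (s - t) < per L Q s := lt_of_le_of_ne (per_mono L Q (Nat.sub_le _ t)) h
        rw [per_lt_iff hL, ← lt_pstart_iff hQ] at hlt
        omega
    · right
      refine ⟨?_, hps.2⟩
      rcases hne with h | h
      · have := pstart_mono (L := L) (Q := Q) (show per L Q s + 1 ≤ Q by omega)
        rw [pstart_self hQ] at this
        omega
      · have hgt : per L Q s < per L Q (s + 2 * t) :=
          lt_of_le_of_ne (per_mono L Q (by omega)) (Ne.symm h)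
        have : (per L Q s + 1) * L ≤ ((s : ℕ) + 2 * t) * Q := (le_per_iff hL).1 hgt
        rw [← pstart_le_iff hQ] at this
        omega
  · intro s _ s' _ h
    exact Fin.ext h

end OneD

/-! ### 2. Hypercubes and their frames on the torus `(ℤ/L)^D` -/

section Torus

variable {D L n : ℕ} (e : Fin n ≃ (Fin D → Fin L))

/-- The `j`-th coordinate of the qubit `q` **relative to the corner `o`**, on the torus: `(x_j(q) − o_j) mod L`.
[cite: BravyiTerhal2009, §1 p. 3 (periodic boundary conditions); BravyiPoulinTerhal2010, p. 1 footnote («open or periodic boundary conditions»)] -/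
def sh (o : Fin D → Fin L) (q : Fin n) (j : Fin D) : ℕ := ((e q j - o j : Fin L) : ℕ)

/-- The **hypercube of side `m` with lowest corner `o`** on the torus: all relative coordinates `< m`
(for `m ≥ L` it is the whole torus). [cite: BravyiPoulinTerhal2010, p. 2 («any square block of size m×m»); Eq. (2) (D dimensions)] -/
def cube (o : Fin D → Fin L) (m : ℕ) : Finset (Fin n) := univ.filter fun q => ∀ j, sh e o q j < m

/-- The **frame** of thickness `t` around the cube `[t, t+m)^D` (relative to the corner `o`): the enlarged cube
`[0, m+2t)^D` minus the shrunk cube `[2t, m)^D` (the region `BC` of Cor. 1 / Fig. 2, «layers of thickness `w`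
adjacent to the surface of `M`» on both sides). [cite: BravyiPoulinTerhal2010, p. 3 (proof sketch after Cor. 1, Fig. 2)] -/
def frame (o : Fin D → Fin L) (m t : ℕ) : Finset (Fin n) :=
  univ.filter fun q => (∀ j, sh e o q j < m + 2 * t) ∧ ¬ (∀ j, 2 * t ≤ sh e o q j ∧ sh e o q j < m)

variable {e}

/-- Relative coordinates are `< L`. [folklore] -/
private theorem sh_lt (o : Fin D → Fin L) (q : Fin n) (j : Fin D) : sh e o q j < L := Fin.isLt _

/-- Membership in a hypercube. [cite: BravyiPoulinTerhal2010, p. 2 («square block of size m×m»)] -/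
@[simp] theorem mem_cube {o : Fin D → Fin L} {m : ℕ} {q : Fin n} : q ∈ cube e o m ↔ ∀ j, sh e o q j < m := by
  simp [cube]

/-- Membership in a frame. [cite: BravyiPoulinTerhal2010, p. 3 (Fig. 2)] -/
theorem mem_frame {o : Fin D → Fin L} {m t : ℕ} {q : Fin n} :
    q ∈ frame e o m t ↔ (∀ j, sh e o q j < m + 2 * t) ∧ ¬ (∀ j, 2 * t ≤ sh e o q j ∧ sh e o q j < m) := by
  simp [frame]

/-- Value of a difference in `Fin L`: `(y − γ) mod L` is `y − γ` or `y + L − γ`. [folklore] -/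
private theorem val_sub_eq {L : ℕ} (y γ : Fin L) :
    ((y - γ : Fin L) : ℕ) = if (γ : ℕ) ≤ y then (y : ℕ) - γ else (y : ℕ) + L - γ := by
  split_ifs with h
  · exact Fin.coe_sub_iff_le.2 h
  · rw [Fin.coe_sub_iff_lt.2 (Fin.lt_def.2 (by omega))]; omega

/-- **Counting points of a box on the torus**: the qubits whose coordinates relative to `o` lie in prescribed
sets `U_j` number `∏_j |U_j|` (the placement `e` and the translation by `o` are bijections).
[cite: BravyiPoulinTerhal2010, p. 1 («a regular D-dimensional cubic lattice»)] -/
theorem card_filter_sub_mem (hL : 0 < L) (o : Fin D → Fin L) (U : Fin D → Finset (Fin L)) :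
    #(univ.filter fun q : Fin n => ∀ j, e q j - o j ∈ U j) = ∏ j, #(U j) := by
  classical
  haveI : NeZero L := ⟨hL.ne'⟩
  let ψ : (Fin D → Fin L) ≃ (Fin D → Fin L) :=
    { toFun := fun f j => f j - o j
      invFun := fun f j => f j + o j
      left_inv := fun f => funext fun j => sub_add_cancel (f j) (o j)
      right_inv := fun f => funext fun j => add_sub_cancel_right (f j) (o j) }
  have hset : (univ.filter fun q : Fin n => ∀ j, e q j - o j ∈ U j) =
      (Fintype.piFinset U).map (e.trans ψ).symm.toEmbedding := by
    ext q
    rw [mem_filter, Finset.mem_map_equiv, Fintype.mem_piFinset]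
    simp [ψ]
  rw [hset, card_map, Fintype.card_piFinset]

/-- The columns `a ≤ x < b` of the circle `Fin L` number `b − a` when `b ≤ L`. [folklore] -/
private theorem card_filter_val_Ico {L a b : ℕ} (hb : b ≤ L) :
    #(univ.filter fun x : Fin L => a ≤ (x : ℕ) ∧ (x : ℕ) < b) = b - a := by
  have hset : (univ.filter fun x : Fin L => a ≤ (x : ℕ) ∧ (x : ℕ) < b) =
      (Finset.Ico a b).attachFin (fun m hm => lt_of_lt_of_le (Finset.mem_Ico.1 hm).2 hb) := by
    ext x
    simp [Finset.mem_attachFin]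
  rw [hset, Finset.card_attachFin, Nat.card_Ico]

/-- At most `m` columns have relative coordinate `< m`. [folklore] -/
private theorem card_filter_val_lt_le {L m : ℕ} : #(univ.filter fun x : Fin L => (x : ℕ) < m) ≤ m := by
  calc #(univ.filter fun x : Fin L => (x : ℕ) < m) ≤ #(Finset.range m) := by
        refine card_le_card_of_injOn Fin.val ?_ ?_
        · intro x hx
          have := (mem_filter.1 (mem_coe.1 hx)).2
          simpa using this
        · intro x _ y _ h
          exact Fin.ext h
    _ = m := card_range m

/-- A hypercube of side `m` holds at most `m^D` qubits. [cite: BravyiPoulinTerhal2010, p. 2] -/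
theorem card_cube_le (hL : 0 < L) (o : Fin D → Fin L) (m : ℕ) : #(cube e o m) ≤ m ^ D := by
  have h := card_filter_sub_mem (e := e) hL o (fun _ => univ.filter fun x : Fin L => (x : ℕ) < m)
  have hset : cube e o m = univ.filter fun q : Fin n => ∀ j, e q j - o j ∈
      (fun _ : Fin D => univ.filter fun x : Fin L => (x : ℕ) < m) j := by
    ext q; simp [cube, sh]
  rw [hset, h]
  calc ∏ j : Fin D, #(univ.filter fun x : Fin L => (x : ℕ) < m) ≤ ∏ _j : Fin D, m :=
        Finset.prod_le_prod' fun j _ => card_filter_val_lt_le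
    _ = m ^ D := by rw [prod_const, card_univ, Fintype.card_fin]

/-- A hypercube of side `m ≤ L` holds exactly `m^D` qubits. [cite: BravyiPoulinTerhal2010, p. 2] -/
theorem card_cube_eq (hL : 0 < L) (o : Fin D → Fin L) {m : ℕ} (hm : m ≤ L) : #(cube e o m) = m ^ D := by
  have h := card_filter_sub_mem (e := e) hL o
    (fun _ => univ.filter fun x : Fin L => 0 ≤ (x : ℕ) ∧ (x : ℕ) < m)
  have hset : cube e o m = univ.filter fun q : Fin n => ∀ j, e q j - o j ∈
      (fun _ : Fin D => univ.filter fun x : Fin L => 0 ≤ (x : ℕ) ∧ (x : ℕ) < m) j := by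
    ext q; simp [cube, sh]
  rw [hset, h]
  simp only [card_filter_val_Ico hm, Nat.sub_zero, prod_const, card_univ, Fintype.card_fin]

/-- **Size of a frame**: `(m+2t)^D − (m−2t)^D` qubits when the enlarged cube does not wrap around the torus
(`m + 2t ≤ L`). [cite: BravyiPoulinTerhal2010, p. 3 («|BC| = cwR for some constant c»)] -/
theorem card_frame_eq (hL : 0 < L) (o : Fin D → Fin L) {m t : ℕ} (hmL : m + 2 * t ≤ L) :
    #(frame e o m t) = (m + 2 * t) ^ D - (m - 2 * t) ^ D := by
  set big : Finset (Fin n) := univ.filter fun q => ∀ j, e q j - o j ∈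
      (fun _ : Fin D => univ.filter fun x : Fin L => 0 ≤ (x : ℕ) ∧ (x : ℕ) < m + 2 * t) j with hbig
  set deep : Finset (Fin n) := univ.filter fun q => ∀ j, e q j - o j ∈
      (fun _ : Fin D => univ.filter fun x : Fin L => 2 * t ≤ (x : ℕ) ∧ (x : ℕ) < m) j with hdeep
  have hset : frame e o m t = big \ deep := by
    ext q; simp [frame, sh, hbig, hdeep, mem_sdiff]
  have hsub : deep ⊆ big := by
    intro q hq
    simp only [hbig, hdeep, mem_filter, mem_univ, true_and] at hq ⊢
    intro j; have := hq j; omega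
  rw [hset, card_sdiff_of_subset hsub, hbig, hdeep, card_filter_sub_mem hL, card_filter_sub_mem hL]
  simp only [card_filter_val_Ico hmL, card_filter_val_Ico (show m ≤ L by omega), Nat.sub_zero, prod_const,
    card_univ, Fintype.card_fin]

/-- `a^D − b^D ≤ (a − b)·D·a^{D−1}` for `b ≤ a` (telescoping). [folklore] -/
private theorem pow_sub_pow_le (a b : ℕ) (hab : b ≤ a) : ∀ D : ℕ, a ^ D - b ^ D ≤ (a - b) * (D * a ^ (D - 1))
  | 0 => by simp
  | D + 1 => by
    have ih := pow_sub_pow_le a b hab D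
    have hbD : b ^ D ≤ a ^ D := Nat.pow_le_pow_left hab D
    rw [Nat.add_sub_cancel]
    -- a^{D+1} ≤ b^{D+1} + (a-b)(D+1)a^D
    apply Nat.sub_le_iff_le_add'.2
    rcases Nat.eq_zero_or_pos D with hD | hD
    · subst hD; simp; omega
    · have haD : a * a ^ (D - 1) = a ^ D := by
        rw [← pow_succ']; congr 1; omega
      have h1 : a ^ D ≤ b ^ D + (a - b) * (D * a ^ (D - 1)) := Nat.sub_le_iff_le_add'.1 ih
      calc a ^ (D + 1) = a * a ^ D := by ring
        _ ≤ a * (b ^ D + (a - b) * (D * a ^ (D - 1))) := Nat.mul_le_mul_left _ h1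
        _ = a * b ^ D + (a - b) * (D * (a * a ^ (D - 1))) := by ring
        _ = (b + (a - b)) * b ^ D + (a - b) * (D * a ^ D) := by rw [haD]; congr 1; rw [Nat.add_sub_cancel' hab]
        _ = b ^ (D + 1) + (a - b) * b ^ D + (a - b) * (D * a ^ D) := by ring
        _ ≤ b ^ (D + 1) + (a - b) * a ^ D + (a - b) * (D * a ^ D) := by gcongr
        _ = b ^ (D + 1) + (a - b) * ((D + 1) * a ^ (D + 1 - 1)) := by rw [Nat.add_sub_cancel]; ring

/-- The frame has at most `4tD(m+2t)^{D−1}` qubits. [cite: BravyiPoulinTerhal2010, p. 3 («|BC| = cwR»)] -/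
theorem card_frame_le (hL : 0 < L) (o : Fin D → Fin L) {m t : ℕ} (hmL : m + 2 * t ≤ L) :
    #(frame e o m t) ≤ 4 * t * (D * (m + 2 * t) ^ (D - 1)) := by
  rw [card_frame_eq hL o hmL]
  refine (pow_sub_pow_le _ _ (by omega) D).trans ?_
  exact Nat.mul_le_mul_right _ (by omega)

end Torus

/-! ### 3. Growing correctable hypercubes (Cor. 1 iterated from single sites) -/

section Growth

variable {D L n : ℕ} {e : Fin n ≃ (Fin D → Fin L)}

/-- **No wrap-around.** If a periodic window of range `t + 1` (corner `c`) contains a point `q₁` of the cube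
`[t, t+m)^D` relative to `o`, and `m + 2t ≤ L`, then relative to `o` the window is an honest box: every point `q`
of the window has `γ_j ≤ y_j(q) ≤ γ_j + t` with `γ_j = (c_j − o_j) mod L`.
[cite: BravyiPoulinTerhal2010, p. 3 (proof sketch after Cor. 1: «Since all the projectors have size at most w, the condition ∂M ⊆ BC is satisfied»)] -/
theorem window_noWrap (hL : 0 < L) {t m : ℕ} (hmL : m + 2 * t ≤ L) {c o : Fin D → Fin L} {q₁ q : Fin n}
    (h₁ : InCubePeriodic (t + 1) c (e q₁)) (hq : InCubePeriodic (t + 1) c (e q))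
    (hin : ∀ j, t ≤ sh e o q₁ j ∧ sh e o q₁ j < t + m) (j : Fin D) :
    ((c j - o j : Fin L) : ℕ) ≤ sh e o q j ∧ sh e o q j ≤ ((c j - o j : Fin L) : ℕ) + t ∧
      ((c j - o j : Fin L) : ℕ) ≤ sh e o q₁ j ∧ sh e o q₁ j ≤ ((c j - o j : Fin L) : ℕ) + t := by
  haveI : NeZero L := ⟨hL.ne'⟩
  have e1 : e q₁ j - c j = (e q₁ j - o j) - (c j - o j) := (sub_sub_sub_cancel_right _ _ _).symm
  have e2 : e q j - c j = (e q j - o j) - (c j - o j) := (sub_sub_sub_cancel_right _ _ _).symm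
  have h1 := h₁ j
  have h2 := hq j
  rw [e1, val_sub_eq] at h1
  rw [e2, val_sub_eq] at h2
  have hγ : ((c j - o j : Fin L) : ℕ) < L := Fin.isLt _
  have hy1 : sh e o q₁ j < L := sh_lt o q₁ j
  have hy : sh e o q j < L := sh_lt o q j
  have hinj := hin j
  unfold sh at *
  split_ifs at h1 h2 <;> omega

/-- **The boundary of a cube lies in its frame.** A generator covered by a periodic window of range `t + 1` that
meets the cube `[t, t+m)^D` (relative to `o`, `m + 2t ≤ L`) and also its complement is supported in the frame.
[cite: BravyiPoulinTerhal2010, p. 3 (proof sketch after Cor. 1) and Def. 1 (∂M)] -/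
theorem subset_frame_of_crossing (hL : 0 < L) {t m : ℕ} (hmL : m + 2 * t ≤ L) {v : SympVec n}
    (hv : IsCubeLocalPeriodic e (t + 1) v) (o : Fin D → Fin L)
    (hin : ∃ q ∈ sympSupport v, ∀ j, t ≤ sh e o q j ∧ sh e o q j < t + m)
    (hout : ∃ q ∈ sympSupport v, ¬ ∀ j, t ≤ sh e o q j ∧ sh e o q j < t + m) :
    ∀ q ∈ sympSupport v, q ∈ frame e o m t := by
  obtain ⟨c, hc⟩ := hv
  obtain ⟨q₁, hq₁, hin⟩ := hin
  obtain ⟨q₂, hq₂, hout⟩ := hout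
  intro q hq
  rw [mem_frame]
  constructor
  · intro j
    have hw := window_noWrap hL hmL (hc q₁ hq₁) (hc q hq) hin j
    have := hin j
    omega
  · intro hdeep
    apply hout
    intro j
    have hw := window_noWrap hL hmL (hc q₁ hq₁) (hc q hq) hin j
    have hw2 := window_noWrap hL hmL (hc q₁ hq₁) (hc q₂ hq₂) hin j
    have := hdeep j
    omega

variable {G : Type*} {g : G → SympVec n} {S : Submodule (ZMod 2) (SympVec n)} {t d : ℕ}

/-- **One expansion step** (Cor. 1): if the generators have range `t + 1`, every cube of side `m` is correctable,
`m + 2t ≤ L` and the frame has fewer than `d` qubits, then every cube of side `m + 2t` is correctable («If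
`|BC| < d` then `BC` is correctable and Corollary 1 would imply that `M ∪ C` is correctable»).
[cite: BravyiPoulinTerhal2010, p. 3 (proof sketch after Cor. 1)] -/
theorem cube_step (hS : S = Submodule.span (ZMod 2) (Set.range g)) (hself : IsSelfOrthogonal S)
    (hg : ∀ a, IsCubeLocalPeriodic e (t + 1) (g a)) (hdist : HasMinDist S d) (hL : 0 < L) {m : ℕ}
    (hmL : m + 2 * t ≤ L) (hfr : (m + 2 * t) ^ D - (m - 2 * t) ^ D < d)
    (hcube : ∀ o, IsCorrectableRegion S (cube e o m)) (o : Fin D → Fin L) :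
    IsCorrectableRegion S (cube e o (m + 2 * t)) := by
  haveI : NeZero L := ⟨hL.ne'⟩
  have htL : t < L := by omega
  let tF : Fin L := ⟨t, htL⟩
  let o' : Fin D → Fin L := fun j => o j + tF
  have hsh : ∀ q j, sh e o' q j = if t ≤ sh e o q j then sh e o q j - t else sh e o q j + L - t := by
    intro q j
    unfold sh
    have h1 : e q j - o' j = (e q j - o j) - tF := sub_add_eq_sub_sub _ _ _
    rw [h1, val_sub_eq]
  have hinner : ∀ q, q ∈ cube e o' m ↔ ∀ j, t ≤ sh e o q j ∧ sh e o q j < t + m := by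
    intro q
    rw [mem_cube]
    refine forall_congr' fun j => ?_
    rw [hsh q j]
    have := sh_lt (e := e) o q j
    split_ifs with h <;> omega
  have hF : IsCorrectableRegion S (frame e o m t) :=
    IsCorrectableRegion.of_card_lt hdist (lt_of_eq_of_lt (card_frame_eq hL o hmL) hfr)
  have hU := (hcube o').union_of_crossing g hS hself hF (fun a hin hout => by
      refine subset_frame_of_crossing hL hmL (hg a) o ?_ ?_
      · obtain ⟨q, hq, hq'⟩ := hin
        exact ⟨q, hq, (hinner q).1 hq'⟩
      · obtain ⟨q, hq, hq'⟩ := hout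
        exact ⟨q, hq, fun h => hq' ((hinner q).2 h)⟩)
  refine hU.mono ?_
  intro q hq
  rw [mem_cube] at hq
  rw [mem_union]
  by_cases h : ∀ j, t ≤ sh e o q j ∧ sh e o q j < t + m
  · exact Or.inl ((hinner q).2 h)
  · refine Or.inr (mem_frame.2 ⟨fun j => ?_, fun hdeep => h fun j => ?_⟩)
    · have := hq j; omega
    · have := hdeep j; have := hq j; omega

/-- **`R ≥ d/(cw)`.** With generators of range `t + 1` (`t ≥ 1`) and minimum distance `d ≥ 2` there is a side
`1 ≤ R ≤ L` such that EVERY hypercube of side `R` (at every corner of the torus) is correctable, and either the frame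
count has reached `d`, `d ≤ (R+2t)^D − (R−2t)^D`, or the cube has (almost) outgrown the torus, `L < R + 2t`: start
from single sites («any region of size smaller than `d` is correctable») and expand while the frames have fewer
than `d` qubits and do not wrap around. [cite: BravyiPoulinTerhal2010, p. 3 («Thus |BC| ≥ d, that is, R ≥ d/(cw) ∼ d»)] -/
theorem exists_correctable_cube (hS : S = Submodule.span (ZMod 2) (Set.range g)) (hself : IsSelfOrthogonal S)
    (hg : ∀ a, IsCubeLocalPeriodic e (t + 1) (g a)) (hdist : HasMinDist S d) (hL : 0 < L) (ht : 1 ≤ t)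
    (hd : 2 ≤ d) :
    ∃ R, 1 ≤ R ∧ R ≤ L ∧ (∀ o, IsCorrectableRegion S (cube e o R)) ∧
      (d ≤ (R + 2 * t) ^ D - (R - 2 * t) ^ D ∨ L < R + 2 * t) := by
  classical
  have hex : ∃ j : ℕ, ¬ ((1 + 2 * t * j + 2 * t) ^ D - (1 + 2 * t * j - 2 * t) ^ D < d ∧
      1 + 2 * t * j + 2 * t ≤ L) := by
    refine ⟨L, fun h => ?_⟩
    have := h.2
    nlinarith
  have hind : ∀ j, j ≤ Nat.find hex → ∀ o, IsCorrectableRegion S (cube e o (1 + 2 * t * j)) := by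
    intro j
    induction j with
    | zero =>
      intro _ o
      refine IsCorrectableRegion.of_card_lt hdist ((card_cube_le hL o _).trans_lt ?_)
      simp only [mul_zero, add_zero, one_pow]
      omega
    | succ j ih =>
      intro hj o
      have hPj := not_not.1 (Nat.find_min hex (show j < Nat.find hex by omega))
      have := cube_step hS hself hg hdist hL hPj.2 hPj.1 (ih (by omega)) o
      rwa [show 1 + 2 * t * (j + 1) = 1 + 2 * t * j + 2 * t by ring]
  refine ⟨1 + 2 * t * Nat.find hex, by omega, ?_, hind _ le_rfl, ?_⟩
  · rcases Nat.eq_zero_or_pos (Nat.find hex) with h0 | hpos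
    · rw [h0]; omega
    · have hPj := not_not.1 (Nat.find_min hex (show Nat.find hex - 1 < Nat.find hex by omega))
      have h2 := hPj.2
      have : 2 * t * Nat.find hex = 2 * t * (Nat.find hex - 1) + 2 * t := by
        rw [← Nat.mul_succ]; congr 1; omega
      omega
  · have hP := Nat.find_spec hex
    rw [not_and_or, not_lt, not_le] at hP
    exact hP

end Growth

/-! ### 4. The partition `Λ = A ∪ B ∪ C` of the torus and `k ≤ |C|` -/

section Partition

variable {D L n : ℕ} (e : Fin n ≃ (Fin D → Fin L)) (Q t : ℕ)

/-- **Region `C`**: qubits with at least two coordinates within `t` of a block boundary («the regions `A` and `B`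
have small corner regions taken out which make up the region `C`»; in `D` dimensions: codimension-`2` seams).
[cite: BravyiPoulinTerhal2010, p. 2 and Fig. 1; Eq. (2) (D dimensions)] -/
def TwoBad (q : Fin n) : Prop :=
  ∃ j j' : Fin D, j ≠ j' ∧ Bad L Q t (e q j : ℕ) ∧ Bad L Q t (e q j' : ℕ)

/-- **Region `A`, labelled by block**: all coordinates in block columns and fewer than two bad coordinates; the
label is the vector of period indices (the block). [cite: BravyiPoulinTerhal2010, p. 2 and Fig. 1 («The regions A and B consist of blocks of size R×R»)] -/
noncomputable def blockLab (q : Fin n) : Option (Fin D → ℕ) :=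
  if (∀ j, ¬ IsCorr L Q t (e q j : ℕ)) ∧ ¬ TwoBad e Q t q then some (fun j => per L Q (e q j : ℕ)) else none

/-- **Region `B`, labelled by corridor segment**: exactly one bad coordinate, and it is a corridor column; the label
records the corridor direction(s) and the period indices. [cite: BravyiPoulinTerhal2010, p. 2 and Fig. 1 (region B)] -/
noncomputable def corrLab (q : Fin n) : Option (Finset (Fin D) × (Fin D → ℕ)) :=
  if (∃ j, IsCorr L Q t (e q j : ℕ)) ∧ ¬ TwoBad e Q t q then
    some (univ.filter (fun j => IsCorr L Q t (e q j : ℕ)), fun j => per L Q (e q j : ℕ))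
  else none

variable {e Q t}

/-- The label of a qubit of `A` is its block. [cite: BravyiPoulinTerhal2010, p. 2 and Fig. 1] -/
theorem blockLab_eq_some_iff {q : Fin n} {P : Fin D → ℕ} :
    blockLab e Q t q = some P ↔
      ((∀ j, ¬ IsCorr L Q t (e q j : ℕ)) ∧ ¬ TwoBad e Q t q) ∧ (fun j => per L Q (e q j : ℕ)) = P := by
  unfold blockLab
  split_ifs with h
  · constructor
    · intro h'; exact ⟨h, Option.some.inj h'⟩
    · rintro ⟨-, h'⟩; rw [h']
  · constructor
    · intro h'; exact absurd h' (by simp)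
    · rintro ⟨h', -⟩; exact absurd h' h

/-- The label of a qubit of `B` is its corridor segment. [cite: BravyiPoulinTerhal2010, p. 2 and Fig. 1] -/
theorem corrLab_eq_some_iff {q : Fin n} {TP : Finset (Fin D) × (Fin D → ℕ)} :
    corrLab e Q t q = some TP ↔ ((∃ j, IsCorr L Q t (e q j : ℕ)) ∧ ¬ TwoBad e Q t q) ∧
      (univ.filter (fun j => IsCorr L Q t (e q j : ℕ)), fun j => per L Q (e q j : ℕ)) = TP := by
  unfold corrLab
  split_ifs with h
  · constructor
    · intro h'; exact ⟨h, Option.some.inj h'⟩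
    · rintro ⟨-, h'⟩; rw [h']
  · constructor
    · intro h'; exact absurd h' (by simp)
    · rintro ⟨h', -⟩; exact absurd h' h

/-- `A ⊔ B ⊔ C = Λ`: a qubit in neither `A` nor `B` lies in `C`.
[cite: BravyiPoulinTerhal2010, p. 2 and Fig. 1 («a partition of the lattice Λ = ABC»)] -/
theorem twoBad_of_labels_none {q : Fin n} (hA : blockLab e Q t q = none) (hB : corrLab e Q t q = none) :
    TwoBad e Q t q := by
  by_contra hC
  unfold blockLab at hA
  unfold corrLab at hB
  by_cases h : ∃ j, IsCorr L Q t (e q j : ℕ)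
  · rw [if_pos ⟨h, hC⟩] at hB; exact absurd hB (by simp)
  · rw [if_pos ⟨fun j hj => h ⟨j, hj⟩, hC⟩] at hA; exact absurd hA (by simp)

/-- Two qubits covered by one periodic window of range `t + 1` are, coordinate by coordinate, at cyclic distance
`≤ t`. [cite: BravyiPoulinTerhal2010, p. 2 («interaction range w»); BravyiTerhal2009, §5 Def. 1 (periodic case)] -/
theorem close_of_inCubePeriodic {t : ℕ} {c : Fin D → Fin L} {q q' : Fin n}
    (hq : InCubePeriodic (t + 1) c (e q)) (hq' : InCubePeriodic (t + 1) c (e q')) (j : Fin D) :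
    Close L t (e q j : ℕ) (e q' j : ℕ) := by
  have h1 := hq j
  have h2 := hq' j
  rw [val_sub_eq] at h1 h2
  have := (e q j).isLt
  have := (e q' j).isLt
  have := (c j).isLt
  unfold Close
  split_ifs at h1 h2 <;> omega

/-- Every block of `A` lies inside a hypercube of side `R` (`L ≤ Q(R+t)`: blocks have width `≤ R`).
[cite: BravyiPoulinTerhal2010, p. 2 («each individual block in A and B is correctable»)] -/
theorem fiber_blockLab_subset_cube (hQ : 0 < Q) (hL : 0 < L) {R : ℕ} (hLQ : L ≤ Q * (R + t))
    (P : Fin D → ℕ) : ∃ o : Fin D → Fin L, fiber (blockLab e Q t) (some P) ⊆ cube e o R := by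
  classical
  by_cases hne : (fiber (blockLab e Q t) (some P)).Nonempty
  · obtain ⟨q₀, hq₀⟩ := hne
    rw [mem_fiber, blockLab_eq_some_iff] at hq₀
    have hP : ∀ j, per L Q (e q₀ j : ℕ) = P j := fun j => congrFun hq₀.2 j
    have hlt : ∀ j, pstart L Q (P j) < L := fun j =>
      lt_of_le_of_lt (pstart_le_of_per_eq hQ hL (hP j)).1 (e q₀ j).isLt
    refine ⟨fun j => ⟨pstart L Q (P j), hlt j⟩, fun q hq => ?_⟩
    rw [mem_fiber, blockLab_eq_some_iff] at hq
    rw [mem_cube]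
    intro j
    have hPj : per L Q (e q j : ℕ) = P j := congrFun hq.2 j
    have hb := block_offset (p := R + t) hQ hL hLQ (hq.1.1 j) hPj
    have hval : sh e (fun j => ⟨pstart L Q (P j), hlt j⟩) q j = (e q j : ℕ) - pstart L Q (P j) :=
      Fin.coe_sub_iff_le.2 (Fin.le_def.2 hb.1)
    rw [hval]
    omega
  · rw [Finset.not_nonempty_iff_eq_empty] at hne
    exact ⟨fun _ => ⟨0, hL⟩, by rw [hne]; exact empty_subset _⟩

/-- Every corridor segment of `B` lies inside a hypercube of side `R` (corridors have width `t ≤ R`; the segment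
starts `t` after its period start in the corridor direction). [cite: BravyiPoulinTerhal2010, p. 2 («each individual block in A and B is correctable»)] -/
theorem fiber_corrLab_subset_cube (hQ : 0 < Q) (hL : 0 < L) (h2 : 2 * t * Q ≤ L) {R : ℕ}
    (hLQ : L ≤ Q * (R + t)) (TP : Finset (Fin D) × (Fin D → ℕ)) :
    ∃ o : Fin D → Fin L, fiber (corrLab e Q t) (some TP) ⊆ cube e o R := by
  classical
  obtain ⟨T, P⟩ := TP
  by_cases hne : (fiber (corrLab e Q t) (some (T, P))).Nonempty
  · obtain ⟨q₀, hq₀⟩ := hne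
    rw [mem_fiber, corrLab_eq_some_iff] at hq₀
    obtain ⟨-, hTP⟩ := hq₀
    simp only [Prod.mk.injEq] at hTP
    obtain ⟨hT0, hP0⟩ := hTP
    have hP : ∀ j, per L Q (e q₀ j : ℕ) = P j := fun j => congrFun hP0 j
    have hTiff0 : ∀ j, j ∈ T ↔ IsCorr L Q t (e q₀ j : ℕ) := fun j => by rw [← hT0]; simp
    have hlt : ∀ j, pstart L Q (P j) + (if j ∈ T then t else 0) < L := by
      intro j
      by_cases hj : j ∈ T
      · rw [if_pos hj]
        exact lt_of_le_of_lt
          (corr_offset (p := R + t) hQ hL h2 hLQ (e q₀ j).isLt ((hTiff0 j).1 hj) (hP j)).1 (e q₀ j).isLt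
      · rw [if_neg hj, add_zero]
        exact lt_of_le_of_lt (pstart_le_of_per_eq hQ hL (hP j)).1 (e q₀ j).isLt
    set o : Fin D → Fin L := fun j => ⟨pstart L Q (P j) + (if j ∈ T then t else 0), hlt j⟩ with ho_def
    have hoT : ∀ j, j ∈ T → (o j : ℕ) = pstart L Q (P j) + t := fun j hj => by
      simp [ho_def, hj]
    have hoT' : ∀ j, j ∉ T → (o j : ℕ) = pstart L Q (P j) := fun j hj => by
      simp [ho_def, hj]
    refine ⟨o, fun q hq => ?_⟩
    rw [mem_fiber, corrLab_eq_some_iff] at hq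
    obtain ⟨-, hTP⟩ := hq
    simp only [Prod.mk.injEq] at hTP
    obtain ⟨hTq, hPq⟩ := hTP
    have hTiff : ∀ j, j ∈ T ↔ IsCorr L Q t (e q j : ℕ) := fun j => by rw [← hTq]; simp
    rw [mem_cube]
    intro j
    have hPj : per L Q (e q j : ℕ) = P j := congrFun hPq j
    by_cases hj : j ∈ T
    · have hco := corr_offset (p := R + t) hQ hL h2 hLQ (e q j).isLt ((hTiff j).1 hj) hPj
      have hle : o j ≤ e q j := Fin.le_def.2 (by rw [hoT j hj]; exact hco.1)
      have hval : sh e o q j = (e q j : ℕ) - (pstart L Q (P j) + t) := by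
        unfold sh; rw [Fin.coe_sub_iff_le.2 hle, hoT j hj]
      rw [hval]
      omega
    · have hb := block_offset (p := R + t) hQ hL hLQ ((hTiff j).not.1 hj) hPj
      have hle : o j ≤ e q j := Fin.le_def.2 (by rw [hoT' j hj]; exact hb.1)
      have hval : sh e o q j = (e q j : ℕ) - pstart L Q (P j) := by
        unfold sh; rw [Fin.coe_sub_iff_le.2 hle, hoT' j hj]
      rw [hval]
      omega
  · rw [Finset.not_nonempty_iff_eq_empty] at hne
    exact ⟨fun _ => ⟨0, hL⟩, by rw [hne]; exact empty_subset _⟩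

/-- **Blocks are decoupled**: a generator of range `t + 1` meets at most one block of `A`.
[cite: BravyiPoulinTerhal2010, p. 2 («any projector Π_a overlaps with at most one» block)] -/
theorem blockLab_separated {v : SympVec n} (hv : IsCubeLocalPeriodic e (t + 1) v) :
    ∀ q ∈ sympSupport v, ∀ q' ∈ sympSupport v, ∀ P P' : Fin D → ℕ,
      blockLab e Q t q = some P → blockLab e Q t q' = some P' → P = P' := by
  obtain ⟨c, hc⟩ := hv
  intro q hq q' hq' P P' hP hP'
  rw [blockLab_eq_some_iff] at hP hP'
  rw [← hP.2, ← hP'.2]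
  funext j
  exact per_eq_of_close_of_not_isCorr (hP.1.1 j) (hP'.1.1 j) (close_of_inCubePeriodic (hc q hq) (hc q' hq') j)

/-- **Corridor segments are decoupled**: a generator of range `t + 1` meets at most one segment of `B` (parallel
segments are a block apart, perpendicular ones are separated by the corner regions `C`).
[cite: BravyiPoulinTerhal2010, p. 2 and Fig. 1] -/
theorem corrLab_separated (hQ : 0 < Q) (hL : 0 < L) (h2 : 2 * t * Q ≤ L) {v : SympVec n}
    (hv : IsCubeLocalPeriodic e (t + 1) v) :
    ∀ q ∈ sympSupport v, ∀ q' ∈ sympSupport v, ∀ TP TP' : Finset (Fin D) × (Fin D → ℕ),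
      corrLab e Q t q = some TP → corrLab e Q t q' = some TP' → TP = TP' := by
  classical
  obtain ⟨c, hc⟩ := hv
  intro q hq q' hq' TP TP' hTP hTP'
  rw [corrLab_eq_some_iff] at hTP hTP'
  obtain ⟨⟨hex, hC⟩, rfl⟩ := hTP
  obtain ⟨⟨hex', hC'⟩, rfl⟩ := hTP'
  have hcl : ∀ j, Close L t (e q j : ℕ) (e q' j : ℕ) := fun j =>
    close_of_inCubePeriodic (hc q hq) (hc q' hq') j
  have hTT : ∀ j, IsCorr L Q t (e q j : ℕ) ↔ IsCorr L Q t (e q' j : ℕ) := by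
    intro j
    constructor
    · intro hj
      by_contra hj'
      have hbad : Bad L Q t (e q' j : ℕ) :=
        bad_of_close_of_isCorr hQ hL h2 (e q j).isLt (e q' j).isLt hj (hcl j)
      obtain ⟨j₁, hj₁⟩ := hex'
      have hne : j ≠ j₁ := fun h => hj' (h ▸ hj₁)
      exact hC' ⟨j, j₁, hne, hbad, hj₁.bad⟩
    · intro hj'
      by_contra hj
      have hbad : Bad L Q t (e q j : ℕ) :=
        bad_of_close_of_isCorr hQ hL h2 (e q' j).isLt (e q j).isLt hj' (hcl j).symm
      obtain ⟨j₁, hj₁⟩ := hex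
      have hne : j ≠ j₁ := fun h => hj (h ▸ hj₁)
      exact hC ⟨j, j₁, hne, hbad, hj₁.bad⟩
  refine Prod.ext ?_ ?_
  · ext j; simp [hTT j]
  · funext j
    by_cases hj : IsCorr L Q t (e q j : ℕ)
    · exact per_eq_of_close_of_isCorr hQ hL h2 (e q j).isLt (e q' j).isLt hj ((hTT j).1 hj) (hcl j)
    · exact per_eq_of_close_of_not_isCorr hj (fun h => hj ((hTT j).2 h)) (hcl j)

/-- **Size of `C`**: at most `D²·|bad|²·L^{D−2}` qubits have two bad coordinates.
[cite: BravyiPoulinTerhal2010, p. 2 and Fig. 1 («small corner regions»)] -/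
theorem card_filter_twoBad_le (hL : 0 < L) :
    #(univ.filter fun q : Fin n => TwoBad e Q t q) ≤ D * D * (#(badFin L Q t) ^ 2 * L ^ (D - 2)) := by
  classical
  haveI : NeZero L := ⟨hL.ne'⟩
  set b := #(badFin L Q t) with hb
  have hpair : ∀ j j' : Fin D, j ≠ j' →
      #(univ.filter fun q : Fin n => Bad L Q t (e q j : ℕ) ∧ Bad L Q t (e q j' : ℕ)) = b ^ 2 * L ^ (D - 2) := by
    intro j j' hjj'
    have h := card_filter_sub_mem (e := e) hL (fun _ => (0 : Fin L))
      (fun i => if i = j ∨ i = j' then badFin L Q t else univ)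
    have hset : (univ.filter fun q : Fin n => Bad L Q t (e q j : ℕ) ∧ Bad L Q t (e q j' : ℕ)) =
        univ.filter fun q : Fin n => ∀ i, e q i - (fun _ => (0 : Fin L)) i ∈
          (fun i => if i = j ∨ i = j' then badFin L Q t else univ) i := by
      ext q
      simp only [mem_filter, mem_univ, true_and, sub_zero]
      constructor
      · rintro ⟨h1, h2⟩ i
        split_ifs with hi
        · rcases hi with rfl | rfl
          · simpa [badFin] using h1
          · simpa [badFin] using h2
        · exact mem_univ _
      · intro h
        refine ⟨?_, ?_⟩
        · have := h j
          rw [if_pos (Or.inl rfl)] at this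
          simpa [badFin] using this
        · have := h j'
          rw [if_pos (Or.inr rfl)] at this
          simpa [badFin] using this
    rw [hset, h]
    simp_rw [apply_ite Finset.card]
    rw [Finset.prod_ite, prod_const, prod_const]
    have hc1 : #(univ.filter fun i : Fin D => i = j ∨ i = j') = 2 := by
      rw [show (univ.filter fun i : Fin D => i = j ∨ i = j') = {j, j'} by ext i; simp]
      exact card_pair hjj'
    have hc2 : #(univ.filter fun i : Fin D => ¬ (i = j ∨ i = j')) = D - 2 := by
      rw [filter_not, card_sdiff_of_subset (filter_subset _ _), hc1, card_univ, Fintype.card_fin]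
    rw [hc1, hc2, card_univ, Fintype.card_fin, hb]
  calc #(univ.filter fun q : Fin n => TwoBad e Q t q)
      ≤ #(((univ : Finset (Fin D × Fin D)).filter fun jj => jj.1 ≠ jj.2).biUnion fun jj =>
          univ.filter fun q : Fin n => Bad L Q t (e q jj.1 : ℕ) ∧ Bad L Q t (e q jj.2 : ℕ)) := by
        refine card_le_card fun q hq => ?_
        simp only [mem_filter, mem_univ, true_and] at hq
        obtain ⟨j, j', hjj', hb1, hb2⟩ := hq
        rw [mem_biUnion]
        exact ⟨(j, j'), by simp [hjj'], by simp [hb1, hb2]⟩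
    _ ≤ ∑ jj ∈ (univ : Finset (Fin D × Fin D)).filter (fun jj => jj.1 ≠ jj.2),
          #(univ.filter fun q : Fin n => Bad L Q t (e q jj.1 : ℕ) ∧ Bad L Q t (e q jj.2 : ℕ)) :=
        card_biUnion_le
    _ = ∑ _jj ∈ (univ : Finset (Fin D × Fin D)).filter (fun jj => jj.1 ≠ jj.2), b ^ 2 * L ^ (D - 2) :=
        sum_congr rfl fun jj hjj => hpair jj.1 jj.2 (mem_filter.1 hjj).2
    _ ≤ D * D * (b ^ 2 * L ^ (D - 2)) := by
        rw [sum_const, smul_eq_mul]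
        refine Nat.mul_le_mul_right _ ?_
        calc #((univ : Finset (Fin D × Fin D)).filter fun jj => jj.1 ≠ jj.2)
            ≤ #(univ : Finset (Fin D × Fin D)) := card_filter_le _ _
          _ = D * D := by simp

variable {G : Type*} {g : G → SympVec n} {S : Submodule (ZMod 2) (SympVec n)}

/-- **`k ≤ |C|`** (Eqs. (5)–(8) with the Union Lemma): if every hypercube of side `R` is correctable, the blocks of
`A` and the segments of `B` are correctable and pairwise decoupled, so `A` and `B` are correctable and `k ≤ |C|`.
[cite: BravyiPoulinTerhal2010, Eqs. (5)–(8) (p. 3) and Lemma 2 applied to the blocks of A and B (p. 2)] -/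
theorem le_card_filter_twoBad {k d R : ℕ} (hS : S = Submodule.span (ZMod 2) (Set.range g))
    (hcode : IsAdditiveCode S k d) (hg : ∀ a, IsCubeLocalPeriodic e (t + 1) (g a)) (hQ : 0 < Q)
    (hL : 0 < L) (h2 : 2 * t * Q ≤ L) (hLQ : L ≤ Q * (R + t))
    (hcube : ∀ o, IsCorrectableRegion S (cube e o R)) :
    k ≤ #(univ.filter fun q : Fin n => TwoBad e Q t q) := by
  classical
  have hA : IsCorrectableRegion S (univ.filter fun q => (blockLab e Q t q).isSome) :=
    isCorrectableRegion_of_fibers (blockLab e Q t) g hS (fun a => blockLab_separated (hg a)) fun P => by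
      obtain ⟨o, ho⟩ := fiber_blockLab_subset_cube (e := e) (t := t) hQ hL hLQ P
      exact (hcube o).mono ho
  have hB : IsCorrectableRegion S (univ.filter fun q => (corrLab e Q t q).isSome) :=
    isCorrectableRegion_of_fibers (corrLab e Q t) g hS (fun a => corrLab_separated hQ hL h2 (hg a)) fun TP => by
      obtain ⟨o, ho⟩ := fiber_corrLab_subset_cube (e := e) hQ hL h2 hLQ TP
      exact (hcube o).mono ho
  refine (le_card_compl_of_isCorrectable hcode hA hB).trans (card_le_card fun q hq => ?_)
  rw [mem_compl, mem_union, not_or] at hq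
  have hA' : blockLab e Q t q = none := Option.not_isSome_iff_eq_none.1 (by simpa using hq.1)
  have hB' : corrLab e Q t q = none := Option.not_isSome_iff_eq_none.1 (by simpa using hq.2)
  exact mem_filter.2 ⟨mem_univ _, twoBad_of_labels_none hA' hB'⟩

end Partition

/-! ### 5. Assembly: the integer inequalities, then the exponent `2/(D−1)` -/

section Assembly

variable {D L n : ℕ}

/-- **Cleaning bound on the distance.** If `M` is correctable and the code has a logical qubit, some non-trivial
logical operator acts only outside `M` (Cleaning Lemma), so `d ≤ |Λ ∖ M|`.
[cite: BravyiTerhal2009, §2 Lemma 1 (Cleaning Lemma), case (2); BravyiPoulinTerhal2010, Definitions and notations (p. 2)] -/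
theorem dist_le_card_compl_of_isCorrectableRegion {S : Submodule (ZMod 2) (SympVec n)} {k d : ℕ}
    (hcode : IsAdditiveCode S k d) (hk : 1 ≤ k) {M : Finset (Fin n)} (hM : IsCorrectableRegion S M) :
    d ≤ #Mᶜ := by
  have huniv := not_isCorrectableRegion_univ hcode hk
  unfold IsCorrectableRegion at huniv
  push Not at huniv
  obtain ⟨v, hvd, -, hvS⟩ := huniv
  have hclean := sup_sympDual_inf_supportedOn_compl_eq hcode.1 hM.inf_le
  have hv : v ∈ S ⊔ (sympDual S ⊓ supportedOn Mᶜ) := by rw [hclean]; exact hvd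
  obtain ⟨s, hs, q, ⟨hqd, hqM⟩, rfl⟩ := Submodule.mem_sup.1 hv
  have hqS : q ∉ S := fun hq => hvS (S.add_mem hs hq)
  exact (hcode.2.2.1 q hqd hqS).trans (sympWeight_le_card_of_mem hqM)

/-- **The integer form of the tradeoff on the torus.** For a stabilizer code with `k ≥ 1` on `(ℤ/L)^D`, `D ≥ 2`,
whose stabilizer space is spanned by generators of range `t + 1` (`t ≥ 1`), there is a length `M ≥ 1` with
`k·M² ≤ 36D²t²·n` and `d ≤ C_B(t,D)·M^{D−1}` — `M` is the block period `R + t` of the partition (or `L`, or `1`, in the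
degenerate regimes: torus smaller than `6t`, blocks smaller than `5t`, blocks outgrowing the torus, `d ≤ 1`).
[cite: BravyiPoulinTerhal2010, Eqs. (5)–(8) with «R ≥ d/(cw)» and «|C| = O(n/R²)» (pp. 2–3); Eq. (2) (D dimensions)] -/
theorem exists_scale {k d t : ℕ} (hD : 2 ≤ D) (ht : 1 ≤ t) (e : Fin n ≃ (Fin D → Fin L))
    {S : Submodule (ZMod 2) (SympVec n)} (hloc : HasLocalGeneratorsPeriodic e (t + 1) S)
    (hcode : IsAdditiveCode S k d) (hk : 1 ≤ k) :
    ∃ M, 1 ≤ M ∧ k * M ^ 2 ≤ 36 * D ^ 2 * t ^ 2 * n ∧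
      d ≤ (4 * t * D * 2 ^ (D - 1) + (6 * t) ^ D + 4 * t * D * (7 * t) ^ (D - 1) + 1) * M ^ (D - 1) := by
  classical
  set CB := 4 * t * D * 2 ^ (D - 1) + (6 * t) ^ D + 4 * t * D * (7 * t) ^ (D - 1) + 1 with hCB
  have hn : n = L ^ D := by
    have h := Fintype.card_congr e
    simpa using h
  have hkn : k ≤ n := by have := hcode.2.1; omega
  have hD2 : 1 ≤ D ^ 2 := Nat.one_le_pow _ _ (by omega)
  have ht2 : 1 ≤ t ^ 2 := Nat.one_le_pow _ _ ht
  have hCA1 : 1 ≤ 36 * D ^ 2 * t ^ 2 := by nlinarith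
  have triv : ∀ {B : ℕ}, d ≤ B → B ≤ CB →
      ∃ M, 1 ≤ M ∧ k * M ^ 2 ≤ 36 * D ^ 2 * t ^ 2 * n ∧ d ≤ CB * M ^ (D - 1) := by
    intro B hdB hB
    refine ⟨1, le_rfl, ?_, ?_⟩
    · rw [one_pow, mul_one]
      exact hkn.trans (Nat.le_mul_of_pos_left n hCA1)
    · rw [one_pow, mul_one]; exact hdB.trans hB
  have hn1 : 1 ≤ n := hk.trans hkn
  have hL : 0 < L := by
    rcases Nat.eq_zero_or_pos L with h | h
    · exfalso; rw [h, zero_pow (by omega)] at hn; omega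
    · exact h
  -- the local generators
  set T : Set (SympVec n) := {v | v ∈ S ∧ IsCubeLocalPeriodic e (t + 1) v} with hT
  have hS : S = Submodule.span (ZMod 2) (Set.range (Subtype.val : T → SympVec n)) := by
    rw [Subtype.range_coe]
    exact le_antisymm hloc (Submodule.span_le.2 fun v hv => hv.1)
  have hg : ∀ a : T, IsCubeLocalPeriodic e (t + 1) (a : SympVec n) := fun a => a.2.2
  -- d ≤ 1
  rcases Nat.lt_or_ge d 2 with hd | hd
  · exact triv (B := 1) (by omega) (by omega)
  -- d ≤ n (cleaning with the empty region)
  have hdn : d ≤ n := by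
    have h := dist_le_card_compl_of_isCorrectableRegion hcode hk
      (IsCorrectableRegion.of_card_lt hcode.2.2.1 (M := (∅ : Finset (Fin n))) (by simp; omega))
    simpa using h
  -- tiny torus
  by_cases hLt : L < 6 * t
  · refine triv hdn ?_
    have : L ^ D ≤ (6 * t) ^ D := Nat.pow_le_pow_left hLt.le D
    rw [hn]; omega
  rw [not_lt] at hLt
  -- growth
  obtain ⟨R, hR1, hRL, hcube, halt⟩ := exists_correctable_cube hS hcode.1 hg hcode.2.2.1 hL ht hd
  have hLD : L ^ (D - 2) * L ^ 2 = L ^ D := by rw [← pow_add]; congr 1; omega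
  rcases halt with hdR | hbig
  swap
  · -- the blocks have outgrown the torus: partition with two periods
    have h2Q : 2 * t * 2 ≤ L := by omega
    have hLQ : L ≤ 2 * (R + t) := by omega
    have hk' := le_card_filter_twoBad hS hcode hg (by norm_num) hL h2Q hLQ hcube
    have hC := card_filter_twoBad_le (e := e) (Q := 2) (t := t) hL
    have hbad := card_badFin_le (L := L) (t := t) (Q := 2) (by norm_num) hL h2Q
    refine ⟨L, hL, ?_, ?_⟩
    · have h1 : k ≤ D * D * ((3 * t * 2) ^ 2 * L ^ (D - 2)) := hk'.trans (hC.trans (by gcongr))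
      calc k * L ^ 2 ≤ D * D * ((3 * t * 2) ^ 2 * L ^ (D - 2)) * L ^ 2 := Nat.mul_le_mul_right _ h1
        _ = 36 * D ^ 2 * t ^ 2 * (L ^ (D - 2) * L ^ 2) := by ring
        _ = 36 * D ^ 2 * t ^ 2 * n := by rw [hLD, hn]
    · have h1 := dist_le_card_compl_of_isCorrectableRegion hcode hk (hcube fun _ => ⟨0, hL⟩)
      rw [card_compl, Fintype.card_fin, card_cube_eq hL _ hRL] at h1
      have h2 : n - R ^ D ≤ L ^ D - (L - 2 * t) ^ D := by
        rw [hn]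
        exact Nat.sub_le_sub_left (Nat.pow_le_pow_left (by omega) D) _
      have h3 := pow_sub_pow_le L (L - 2 * t) (Nat.sub_le _ _) D
      have h4 : (L - (L - 2 * t)) * (D * L ^ (D - 1)) ≤ CB * L ^ (D - 1) := by
        rw [show L - (L - 2 * t) = 2 * t by omega]
        have hcb : 2 * t * D ≤ CB := by
          have h2D : 1 ≤ 2 ^ (D - 1) := Nat.one_le_two_pow
          have : 2 * t * D ≤ 4 * t * D * 2 ^ (D - 1) :=
            calc 2 * t * D ≤ 4 * t * D := Nat.mul_le_mul_right _ (by omega)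
              _ = 4 * t * D * 1 := (mul_one _).symm
              _ ≤ 4 * t * D * 2 ^ (D - 1) := Nat.mul_le_mul_left _ h2D
          omega
        calc 2 * t * (D * L ^ (D - 1)) = (2 * t * D) * L ^ (D - 1) := by ring
          _ ≤ CB * L ^ (D - 1) := Nat.mul_le_mul_right _ hcb
      omega
  · -- the frame count has reached d: d ≤ 4tD (R+2t)^(D-1)
    have hd4 : d ≤ 4 * t * (D * (R + 2 * t) ^ (D - 1)) :=
      hdR.trans ((pow_sub_pow_le _ _ (by omega) D).trans (Nat.mul_le_mul_right _ (by omega)))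
    by_cases hR5 : R < 5 * t
    · refine triv hd4 ?_
      have : (R + 2 * t) ^ (D - 1) ≤ (7 * t) ^ (D - 1) := Nat.pow_le_pow_left (by omega) _
      calc 4 * t * (D * (R + 2 * t) ^ (D - 1)) ≤ 4 * t * (D * (7 * t) ^ (D - 1)) := by gcongr
        _ = 4 * t * D * (7 * t) ^ (D - 1) := by ring
        _ ≤ CB := by omega
    rw [not_lt] at hR5
    -- the partition with Q = ⌈L/p⌉ near-equal periods, p = R + t
    set p := R + t with hp
    have hp0 : 0 < p := by omega
    set Q := (L + p - 1) / p with hQdef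
    have hQ1 : 1 ≤ Q := by
      rw [hQdef, Nat.le_div_iff_mul_le hp0]; omega
    have hdm := Nat.div_add_mod (L + p - 1) p
    have hml := Nat.mod_lt (L + p - 1) hp0
    have hLQ : L ≤ Q * p := by
      have : p * ((L + p - 1) / p) = Q * p := by rw [hQdef]; ring
      omega
    have hQp : Q * p < L + p := by
      have : p * ((L + p - 1) / p) = Q * p := by rw [hQdef]; ring
      omega
    have hQone : L ≤ p → Q = 1 := by
      intro hpL
      have : Q < 2 := by
        by_contra h
        rw [not_lt] at h
        have : 2 * p ≤ Q * p := Nat.mul_le_mul_right _ h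
        omega
      omega
    have h2Q : 2 * t * Q ≤ L := by
      rcases Nat.lt_or_ge p L with hpL | hpL
      · have h1 : 2 * t * (L + p) ≤ L * p :=
          calc 2 * t * (L + p) ≤ 2 * t * (L + L) := Nat.mul_le_mul_left _ (by omega)
            _ = (4 * t) * L := by ring
            _ ≤ p * L := Nat.mul_le_mul_right _ (by omega)
            _ = L * p := by ring
        have h3 : 2 * t * Q * p < L * p :=
          calc 2 * t * Q * p = 2 * t * (Q * p) := by ring
            _ < 2 * t * (L + p) := Nat.mul_lt_mul_of_pos_left hQp (by omega)
            _ ≤ L * p := h1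
        exact le_of_lt (Nat.lt_of_mul_lt_mul_right h3)
      · rw [hQone hpL]; omega
    have hk' := le_card_filter_twoBad hS hcode hg (by omega) hL h2Q hLQ hcube
    have hC := card_filter_twoBad_le (e := e) (Q := Q) (t := t) hL
    have hbad := card_badFin_le (L := L) (t := t) (by omega : 0 < Q) hL h2Q
    have hk2 : k ≤ D * D * ((3 * t * Q) ^ 2 * L ^ (D - 2)) := hk'.trans (hC.trans (by gcongr))
    rcases Nat.lt_or_ge p L with hpL | hpL
    · -- at least one full period: M = p
      refine ⟨p, hp0, ?_, ?_⟩
      · have hQp2 : Q * p ≤ 2 * L := by omega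
        calc k * p ^ 2 ≤ D * D * ((3 * t * Q) ^ 2 * L ^ (D - 2)) * p ^ 2 := Nat.mul_le_mul_right _ hk2
          _ = 9 * D ^ 2 * t ^ 2 * (Q * p) ^ 2 * L ^ (D - 2) := by ring
          _ ≤ 9 * D ^ 2 * t ^ 2 * (2 * L) ^ 2 * L ^ (D - 2) := by gcongr
          _ = 36 * D ^ 2 * t ^ 2 * (L ^ (D - 2) * L ^ 2) := by ring
          _ = 36 * D ^ 2 * t ^ 2 * n := by rw [hLD, hn]
      · have h1 : (R + 2 * t) ^ (D - 1) ≤ (2 * p) ^ (D - 1) := Nat.pow_le_pow_left (by omega) _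
        calc d ≤ 4 * t * (D * (R + 2 * t) ^ (D - 1)) := hd4
          _ ≤ 4 * t * (D * (2 * p) ^ (D - 1)) := by gcongr
          _ = (4 * t * D * 2 ^ (D - 1)) * p ^ (D - 1) := by rw [mul_pow]; ring
          _ ≤ CB * p ^ (D - 1) := Nat.mul_le_mul_right _ (by omega)
    · -- less than one period: M = L
      have hQ1' := hQone hpL
      refine ⟨L, hL, ?_, ?_⟩
      · calc k * L ^ 2 ≤ D * D * ((3 * t * Q) ^ 2 * L ^ (D - 2)) * L ^ 2 := Nat.mul_le_mul_right _ hk2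
          _ = 9 * D ^ 2 * t ^ 2 * Q ^ 2 * (L ^ (D - 2) * L ^ 2) := by ring
          _ ≤ 36 * D ^ 2 * t ^ 2 * (L ^ (D - 2) * L ^ 2) := by
              rw [hQ1']; exact Nat.mul_le_mul_right _ (by nlinarith)
          _ = 36 * D ^ 2 * t ^ 2 * n := by rw [hLD, hn]
      · have h1 : (R + 2 * t) ^ (D - 1) ≤ (2 * L) ^ (D - 1) := Nat.pow_le_pow_left (by omega) _
        calc d ≤ 4 * t * (D * (R + 2 * t) ^ (D - 1)) := hd4
          _ ≤ 4 * t * (D * (2 * L) ^ (D - 1)) := by gcongr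
          _ = (4 * t * D * 2 ^ (D - 1)) * L ^ (D - 1) := by rw [mul_pow]; ring
          _ ≤ CB * L ^ (D - 1) := Nat.mul_le_mul_right _ (by omega)

/-- **From the integer inequalities to the exponent `α = 2/(D−1)`**: `kM² ≤ C_A n` and `d ≤ C_B M^{D−1}` give
`k·d^{2/(D−1)} ≤ C_A C_B^{2/(D−1)}·n`. [cite: BravyiPoulinTerhal2010, Eq. (2) («k ≤ c n/d^α, α = 2/(D−1)»)] -/
theorem real_step {D k d n M CA CB : ℕ} (hD : 2 ≤ D) (h1 : k * M ^ 2 ≤ CA * n) (h2 : d ≤ CB * M ^ (D - 1)) :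
    (k : ℝ) * (d : ℝ) ^ ((2 : ℝ) / ((D : ℝ) - 1)) ≤
      (CA : ℝ) * (CB : ℝ) ^ ((2 : ℝ) / ((D : ℝ) - 1)) * n := by
  have hD1 : (0 : ℝ) < (D : ℝ) - 1 := by
    have : (2 : ℝ) ≤ D := by exact_mod_cast hD
    linarith
  set α : ℝ := 2 / ((D : ℝ) - 1) with hα
  have hα0 : 0 ≤ α := by positivity
  have hd' : (d : ℝ) ≤ (CB : ℝ) * (M : ℝ) ^ (D - 1) := by exact_mod_cast h2
  have hpow : ((M : ℝ) ^ (D - 1)) ^ α = (M : ℝ) ^ 2 := by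
    rw [← Real.rpow_natCast (M : ℝ) (D - 1), ← Real.rpow_mul (Nat.cast_nonneg M)]
    have : ((D - 1 : ℕ) : ℝ) * α = 2 := by
      rw [Nat.cast_sub (by omega), Nat.cast_one, hα]
      field_simp
    rw [this, Real.rpow_two]
  have hdα : (d : ℝ) ^ α ≤ (CB : ℝ) ^ α * (M : ℝ) ^ 2 := by
    calc (d : ℝ) ^ α ≤ ((CB : ℝ) * (M : ℝ) ^ (D - 1)) ^ α :=
          Real.rpow_le_rpow (Nat.cast_nonneg d) hd' hα0
      _ = (CB : ℝ) ^ α * ((M : ℝ) ^ (D - 1)) ^ α := Real.mul_rpow (Nat.cast_nonneg CB) (by positivity)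
      _ = (CB : ℝ) ^ α * (M : ℝ) ^ 2 := by rw [hpow]
  have h1' : (k : ℝ) * (M : ℝ) ^ 2 ≤ (CA : ℝ) * n := by exact_mod_cast h1
  calc (k : ℝ) * (d : ℝ) ^ α ≤ (k : ℝ) * ((CB : ℝ) ^ α * (M : ℝ) ^ 2) :=
        mul_le_mul_of_nonneg_left hdα (Nat.cast_nonneg k)
    _ = (CB : ℝ) ^ α * ((k : ℝ) * (M : ℝ) ^ 2) := by ring
    _ ≤ (CB : ℝ) ^ α * ((CA : ℝ) * n) := mul_le_mul_of_nonneg_left h1' (by positivity)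
    _ = (CA : ℝ) * (CB : ℝ) ^ α * n := by ring

end Assembly

end BPTTorus

/-! ### Locality on the torus: monotonicity, and open boundary ⇒ periodic boundary -/

section Locality

variable {D L n : ℕ}

/-- A periodic hypercube with `r^D` vertices lies in the one with `r'^D ≥ r^D` vertices and the same corner.
[cite: BravyiTerhal2009, §1 p. 3 (hypercube with r^D vertices)] -/
theorem InCubePeriodic.mono {r r' : ℕ} (h : r ≤ r') {c x : Fin D → Fin L} (hx : InCubePeriodic r c x) :
    InCubePeriodic r' c x :=
  fun i => (hx i).trans_le h

/-- `r`-local on the torus implies `r'`-local for `r ≤ r'`. [cite: BravyiTerhal2009, §1.1 Thm. 1 (hypothesis on the generators)] -/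
theorem IsCubeLocalPeriodic.mono {e : Fin n ≃ (Fin D → Fin L)} {r r' : ℕ} (h : r ≤ r') {v : SympVec n}
    (hv : IsCubeLocalPeriodic e r v) : IsCubeLocalPeriodic e r' v := by
  obtain ⟨c, hc⟩ := hv
  exact ⟨c, fun i hi => (hc i hi).mono h⟩

/-- Local generators of range `r` on the torus are local generators of every range `r' ≥ r`.
[cite: BravyiPoulinTerhal2010, Definitions and notations (p. 2: interaction range w)] -/
theorem HasLocalGeneratorsPeriodic.mono {e : Fin n ≃ (Fin D → Fin L)} {r r' : ℕ} (h : r ≤ r')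
    {S : Submodule (ZMod 2) (SympVec n)} (hS : HasLocalGeneratorsPeriodic e r S) :
    HasLocalGeneratorsPeriodic e r' S :=
  hS.trans (Submodule.span_mono fun _ hv => ⟨hv.1, hv.2.mono h⟩)

/-- An open-boundary hypercube with corner `c` is contained in the periodic hypercube with the same corner
(open-boundary locality implies torus locality). [cite: BravyiTerhal2009, §1.1 Thm. 1 («both periodic and open boundary conditions»)] -/
theorem InCube.toPeriodic {r : ℕ} {c x : Fin D → Fin L} (h : InCube r c x) : InCubePeriodic r c x := by
  intro i
  obtain ⟨h1, h2⟩ := h i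
  show ((x i - c i : Fin L) : ℕ) < r
  rw [Fin.coe_sub_iff_le.2 (Fin.le_def.2 h1)]
  omega

/-- `r`-local with open boundaries implies `r`-local on the torus. [cite: BravyiTerhal2009, §1.1 Thm. 1] -/
theorem IsCubeLocal.toPeriodic {e : Fin n ≃ (Fin D → Fin L)} {r : ℕ} {v : SympVec n}
    (h : IsCubeLocal e r v) : IsCubeLocalPeriodic e r v := by
  obtain ⟨c, hc⟩ := h
  exact ⟨c, fun i hi => (hc i hi).toPeriodic⟩

/-- Local generators with open boundaries are local generators on the torus.
[cite: BravyiPoulinTerhal2010, p. 1 («our results can be easily extended to … periodic boundary conditions»)] -/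
theorem HasLocalGenerators.toPeriodic {e : Fin n ≃ (Fin D → Fin L)} {r : ℕ}
    {S : Submodule (ZMod 2) (SympVec n)} (h : HasLocalGenerators e r S) : HasLocalGeneratorsPeriodic e r S :=
  h.trans (Submodule.span_mono fun _ hv => ⟨hv.1, hv.2.toPeriodic⟩)

end Locality

/-! ### The theorems -/

/-- **Bravyi–Poulin–Terhal 2010, Eq. (2), on the `D`-dimensional torus — proved.** «Generalizing our techniques to
quantum codes defined on a `D`-dimensional lattice yields `k ≤ c n/d^α`, `α = 2/(D−1)`» … «More strictly, our
analysis applies to the regular `D`-dimensional cubic lattice with open or periodic boundary conditions.» For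
STABILIZER codes on qubits: for every dimension `D ≥ 2` and interaction range `w` there is `c = c(w, D) > 0` such that
every stabilizer code on the torus `(ℤ/L)^D` (`n = L^D` qubits placed by `e`) whose stabilizer space is spanned by
generators each covered by a hypercube with `w^D` vertices taken modulo `L` satisfies `k · d^{2/(D−1)} ≤ c · n` for
its number of logical qubits `k` and every `d` below which it has no logical operator. The Letter prints no proof
of Eq. (2); this is its 2D argument (Eqs. (5)–(8), Lemma 2, Cor. 1) run in `D` dimensions with hypercube blocks of
side `R ∼ (d/w)^{1/(D−1)}`, corridor slabs of width `w` and the codimension-`2` corner region `C` (`k ≤ |C| = O(w²n/R²)`),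
on near-equal cyclic periods of the torus; constant far from optimal. Column: proved theorem (discharging the
`TODO(general form)` lines «D-dimensional Eq. (2)» and «periodic boundary conditions» of `BravyiPoulinTerhal2010_kd2_le_cn`;
commuting-projector codes on qudits remain outside the tree's vocabulary).
[cite: BravyiPoulinTerhal2010, Eq. (2) (p. 2) and footnote «regular D-dimensional cubic lattice with open or periodic boundary conditions» (p. 2), with the proof of Eq. (1) on pp. 2–4] -/
theorem BravyiPoulinTerhal2010_eq2_torus (D w : ℕ) (hD : 2 ≤ D) :
    ∃ c : ℝ, 0 < c ∧ ∀ (L n k d : ℕ) (e : Fin n ≃ (Fin D → Fin L)) (S : Submodule (ZMod 2) (SympVec n)),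
      HasLocalGeneratorsPeriodic e w S → IsAdditiveCode S k d →
        (k : ℝ) * (d : ℝ) ^ ((2 : ℝ) / ((D : ℝ) - 1)) ≤ c * n := by
  obtain ⟨t, ht, hwt⟩ : ∃ t : ℕ, 1 ≤ t ∧ w ≤ t + 1 := ⟨max w 2 - 1, by omega, by omega⟩
  refine ⟨((36 * D ^ 2 * t ^ 2 : ℕ) : ℝ) *
      ((4 * t * D * 2 ^ (D - 1) + (6 * t) ^ D + 4 * t * D * (7 * t) ^ (D - 1) + 1 : ℕ) : ℝ) ^
        ((2 : ℝ) / ((D : ℝ) - 1)), ?_, ?_⟩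
  · have hCA : (0 : ℝ) < ((36 * D ^ 2 * t ^ 2 : ℕ) : ℝ) := by
      have hD2 : 1 ≤ D ^ 2 := Nat.one_le_pow _ _ (by omega)
      have ht2 : 1 ≤ t ^ 2 := Nat.one_le_pow _ _ ht
      exact_mod_cast (show 0 < 36 * D ^ 2 * t ^ 2 by nlinarith)
    have hCB : (0 : ℝ) < ((4 * t * D * 2 ^ (D - 1) + (6 * t) ^ D + 4 * t * D * (7 * t) ^ (D - 1) + 1 : ℕ) : ℝ) := by
      exact_mod_cast Nat.succ_pos _
    positivity
  · intro L n k d e S hloc hcode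
    rcases Nat.eq_zero_or_pos k with hk | hk
    · rw [hk, Nat.cast_zero, zero_mul]
      positivity
    · obtain ⟨M, -, h1, h2⟩ := BPTTorus.exists_scale hD ht e (hloc.mono hwt) hcode hk
      exact BPTTorus.real_step hD h1 h2

/-- **Bravyi–Poulin–Terhal 2010, Eq. (2), open boundary conditions** (`Λ = {1,…,L}^D`, generators covered by
hypercubes with `w^D` vertices read inside the lattice): `k · d^{2/(D−1)} ≤ c(w, D) · n`, from the torus form, an
open-boundary hypercube being contained in the periodic one with the same corner.
[cite: BravyiPoulinTerhal2010, Eq. (2) (p. 2) with the footnote «open or periodic boundary conditions»] -/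
theorem BravyiPoulinTerhal2010_eq2 (D w : ℕ) (hD : 2 ≤ D) :
    ∃ c : ℝ, 0 < c ∧ ∀ (L n k d : ℕ) (e : Fin n ≃ (Fin D → Fin L)) (S : Submodule (ZMod 2) (SympVec n)),
      HasLocalGenerators e w S → IsAdditiveCode S k d →
        (k : ℝ) * (d : ℝ) ^ ((2 : ℝ) / ((D : ℝ) - 1)) ≤ c * n := by
  obtain ⟨c, hc, h⟩ := BravyiPoulinTerhal2010_eq2_torus D w hD
  exact ⟨c, hc, fun L n k d e S hloc hcode => h L n k d e S hloc.toPeriodic hcode⟩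

/-- **Bravyi–Poulin–Terhal 2010, `k d² ≤ c n` on the 2D torus** (periodic boundary conditions, the case `D = 2`
of Eq. (2)): for every range `w` there is `c = c(w) > 0` with `k d² ≤ c n` for every stabilizer code on the
`L × L` torus with `w`-local generators — the periodic form of the tree's named fact
`BravyiPoulinTerhal2010_kd2_le_cn`. [cite: BravyiPoulinTerhal2010, Eq. (1) (p. 1) with «our results can be easily extended to … periodic boundary conditions» (p. 1)] -/
theorem BravyiPoulinTerhal2010_kd2_le_cn_torus (w : ℕ) :
    ∃ c : ℝ, 0 < c ∧ ∀ (L n k d : ℕ) (e : Fin n ≃ (Fin 2 → Fin L)) (S : Submodule (ZMod 2) (SympVec n)),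
      HasLocalGeneratorsPeriodic e w S → IsAdditiveCode S k d → (k : ℝ) * (d : ℝ) ^ 2 ≤ c * n := by
  obtain ⟨c, hc, h⟩ := BravyiPoulinTerhal2010_eq2_torus 2 w le_rfl
  refine ⟨c, hc, fun L n k d e S hloc hcode => ?_⟩
  have key := h L n k d e S hloc hcode
  have hexp : (2 : ℝ) / (((2 : ℕ) : ℝ) - 1) = ((2 : ℕ) : ℝ) := by norm_num
  rw [hexp, Real.rpow_natCast] at key
  exact key

end Literature.InformationTheory.QuantumCodes
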